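import Mathlib

/-!
# Inclusion monotonicity and the all-β cover for five levels

Kernel anchors for `DENSITY-XY.md` ADDENDUM G‴ (repair cell b2b-imbrie, XY / free-fermion rung),
Lemma G.27 and Cover Lemma G.28, at `n = 5` levels.  Context: for levels `x₁, …, xₙ` and spectral
weights `w` in the simplex put `W_S = (∏_{i∈S} wᵢ) Δ(x_S)²`, `D_k = Σ_{|S|=k} W_S`,
`in_k(m) = Σ_{S ∋ m} W_S`, `out_k(m) = D_k - in_k(m)`.  G.27: the normalised weights `W_S / D_k` are the
discrete orthogonal-polynomial ensemble of `μ = Σ wᵢ δ_{xᵢ}`, so `in_k(m)/D_k = w_m Σ_{a<k} p_a(x_m)²`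
is nondecreasing in `k`; in Hankel coordinates this is the polynomial identity
`H_k(s) H_k(t) - H_{k+1}(s) H_{k-1}(t) = Q_k(x)²` (`christoffelStep_*` below, free Hankel variables
`s_a`, `t_a = x² s_a - 2x s_{a+1} + s_{a+2}` the moments of `(x-y)² μ(dy)`), transported to subset
sums by Cauchy–Binet (`hankelD₅_*`, `hankelIn₅_*`).  Consequence (`letters₅`): every level satisfies
`s₀ · in_k(m) ≥ w_m · D_k` (`k = 2, 3`) and `w_m · out₄(m) ≤ (s₀ - w_m) · in₄(m)`; hence
(`coverB_five`, G.28 at `n = 5`): for every strictly increasing `x` and every `w` in the open simplex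
some level `m` has `w_m ≥ 1/5` and `out_k(m) ≤ 4 · in_k(m)` for `k = 2, 3, 4` — the cover
`Δ° ⊂ ⋃ₘ B_m(1/5, 1/4)` behind Theorem G.29 (`𝒰₅ ≤ 5^{11/2} 𝒰₄`).  Elementary real algebra only;
nothing here asserts anything about the interacting chain (LLA).
-/

namespace Literature.MathematicalPhysics.QuantumLattice.Imbrie2016


/-- G.27(e) in Hankel coordinates, `k = 1`: `H_1(s)·H_1(t) - H_2(s)·H_0(t) = Q_1(x)²` with
`t_a = x² s_a - 2x s_(a+1) + s_(a+2)` (free variables `s_a`).  [folklore] -/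
theorem christoffelStep_one (s₀ s₁ s₂ x : ℝ) :
    s₀ * (x ^ 2 * s₀ - 2 * x * s₁ + s₂)
      - (s₀ * s₂
        - s₁ * s₁) * 1
    = (s₀ * x
        - 1 * s₁) ^ 2 := by
  ring

/-- G.27(e) in Hankel coordinates, `k = 2`: `H_2(s)·H_2(t) - H_3(s)·H_1(t) = Q_2(x)²` with
`t_a = x² s_a - 2x s_(a+1) + s_(a+2)` (free variables `s_a`).  [folklore] -/
theorem christoffelStep_two (s₀ s₁ s₂ s₃ s₄ x : ℝ) :
    (s₀ * s₂
        - s₁ * s₁) * ((x ^ 2 * s₀ - 2 * x * s₁ + s₂) * (x ^ 2 * s₂ - 2 * x * s₃ + s₄)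
        - (x ^ 2 * s₁ - 2 * x * s₂ + s₃) * (x ^ 2 * s₁ - 2 * x * s₂ + s₃))
      - (s₀ * s₂ * s₄
        - s₀ * s₃ * s₃
        - s₁ * s₁ * s₄
        + s₁ * s₃ * s₂
        + s₂ * s₁ * s₃
        - s₂ * s₂ * s₂) * (x ^ 2 * s₀ - 2 * x * s₁ + s₂)
    = (s₀ * s₂ * x ^ 2
        - s₀ * x * s₃
        - s₁ * s₁ * x ^ 2
        + s₁ * x * s₂
        + 1 * s₁ * s₃
        - 1 * s₂ * s₂) ^ 2 := by
  ring

/-- G.27(e) in Hankel coordinates, `k = 3`: `H_3(s)·H_3(t) - H_4(s)·H_2(t) = Q_3(x)²` with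
`t_a = x² s_a - 2x s_(a+1) + s_(a+2)` (free variables `s_a`).  [folklore] -/
theorem christoffelStep_three (s₀ s₁ s₂ s₃ s₄ s₅ s₆ x : ℝ) :
    (s₀ * s₂ * s₄
        - s₀ * s₃ * s₃
        - s₁ * s₁ * s₄
        + s₁ * s₃ * s₂
        + s₂ * s₁ * s₃
        - s₂ * s₂ * s₂) * ((x ^ 2 * s₀ - 2 * x * s₁ + s₂) * (x ^ 2 * s₂ - 2 * x * s₃ + s₄) * (x ^ 2 * s₄ - 2 * x * s₅ + s₆)
        - (x ^ 2 * s₀ - 2 * x * s₁ + s₂) * (x ^ 2 * s₃ - 2 * x * s₄ + s₅) * (x ^ 2 * s₃ - 2 * x * s₄ + s₅)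
        - (x ^ 2 * s₁ - 2 * x * s₂ + s₃) * (x ^ 2 * s₁ - 2 * x * s₂ + s₃) * (x ^ 2 * s₄ - 2 * x * s₅ + s₆)
        + (x ^ 2 * s₁ - 2 * x * s₂ + s₃) * (x ^ 2 * s₃ - 2 * x * s₄ + s₅) * (x ^ 2 * s₂ - 2 * x * s₃ + s₄)
        + (x ^ 2 * s₂ - 2 * x * s₃ + s₄) * (x ^ 2 * s₁ - 2 * x * s₂ + s₃) * (x ^ 2 * s₃ - 2 * x * s₄ + s₅)
        - (x ^ 2 * s₂ - 2 * x * s₃ + s₄) * (x ^ 2 * s₂ - 2 * x * s₃ + s₄) * (x ^ 2 * s₂ - 2 * x * s₃ + s₄))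
      - (s₀ * s₂ * s₄ * s₆
        - s₀ * s₂ * s₅ * s₅
        - s₀ * s₃ * s₃ * s₆
        + s₀ * s₃ * s₅ * s₄
        + s₀ * s₄ * s₃ * s₅
        - s₀ * s₄ * s₄ * s₄
        - s₁ * s₁ * s₄ * s₆
        + s₁ * s₁ * s₅ * s₅
        + s₁ * s₃ * s₂ * s₆
        - s₁ * s₃ * s₅ * s₃
        - s₁ * s₄ * s₂ * s₅
        + s₁ * s₄ * s₄ * s₃
        + s₂ * s₁ * s₃ * s₆
        - s₂ * s₁ * s₅ * s₄
        - s₂ * s₂ * s₂ * s₆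
        + s₂ * s₂ * s₅ * s₃
        + s₂ * s₄ * s₂ * s₄
        - s₂ * s₄ * s₃ * s₃
        - s₃ * s₁ * s₃ * s₅
        + s₃ * s₁ * s₄ * s₄
        + s₃ * s₂ * s₂ * s₅
        - s₃ * s₂ * s₄ * s₃
        - s₃ * s₃ * s₂ * s₄
        + s₃ * s₃ * s₃ * s₃) * ((x ^ 2 * s₀ - 2 * x * s₁ + s₂) * (x ^ 2 * s₂ - 2 * x * s₃ + s₄)
        - (x ^ 2 * s₁ - 2 * x * s₂ + s₃) * (x ^ 2 * s₁ - 2 * x * s₂ + s₃))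
    = (s₀ * s₂ * s₄ * x ^ 3
        - s₀ * s₂ * x ^ 2 * s₅
        - s₀ * s₃ * s₃ * x ^ 3
        + s₀ * s₃ * x ^ 2 * s₄
        + s₀ * x * s₃ * s₅
        - s₀ * x * s₄ * s₄
        - s₁ * s₁ * s₄ * x ^ 3
        + s₁ * s₁ * x ^ 2 * s₅
        + s₁ * s₃ * s₂ * x ^ 3
        - s₁ * s₃ * x ^ 2 * s₃
        - s₁ * x * s₂ * s₅
        + s₁ * x * s₄ * s₃
        + s₂ * s₁ * s₃ * x ^ 3
        - s₂ * s₁ * x ^ 2 * s₄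
        - s₂ * s₂ * s₂ * x ^ 3
        + s₂ * s₂ * x ^ 2 * s₃
        + s₂ * x * s₂ * s₄
        - s₂ * x * s₃ * s₃
        - 1 * s₁ * s₃ * s₅
        + 1 * s₁ * s₄ * s₄
        + 1 * s₂ * s₂ * s₅
        - 1 * s₂ * s₄ * s₃
        - 1 * s₃ * s₂ * s₄
        + 1 * s₃ * s₃ * s₃) ^ 2 := by
  ring

/-- Cauchy–Binet at five levels, `k = 2`: `D₂ = s₀ s₂ - s₁²`.  [folklore] -/
theorem hankelD₅_two (x₁ x₂ x₃ x₄ x₅ w₁ w₂ w₃ w₄ w₅ : ℝ) :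
    (w₁ * w₂ * ((x₂ - x₁)) ^ 2 + w₁ * w₃ * ((x₃ - x₁)) ^ 2 + w₁ * w₄ * ((x₄ - x₁)) ^ 2
      + w₁ * w₅ * ((x₅ - x₁)) ^ 2 + w₂ * w₃ * ((x₃ - x₂)) ^ 2 + w₂ * w₄ * ((x₄ - x₂)) ^ 2
      + w₂ * w₅ * ((x₅ - x₂)) ^ 2 + w₃ * w₄ * ((x₄ - x₃)) ^ 2 + w₃ * w₅ * ((x₅ - x₃)) ^ 2
      + w₄ * w₅ * ((x₅ - x₄)) ^ 2)
    = ((w₁ + w₂ + w₃ + w₄ + w₅) * (w₁ * x₁ ^ 2 + w₂ * x₂ ^ 2 + w₃ * x₃ ^ 2 + w₄ * x₄ ^ 2 + w₅ * x₅ ^ 2)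
        - (w₁ * x₁ + w₂ * x₂ + w₃ * x₃ + w₄ * x₄ + w₅ * x₅) * (w₁ * x₁ + w₂ * x₂ + w₃ * x₃ + w₄ * x₄ + w₅ * x₅)) := by
  ring

/-- Cauchy–Binet at five levels, `k = 3`: `D₃ = det[s_(a+b)]_(a,b<3)`.  [folklore] -/
theorem hankelD₅_three (x₁ x₂ x₃ x₄ x₅ w₁ w₂ w₃ w₄ w₅ : ℝ) :
    (w₁ * w₂ * w₃ * ((x₂ - x₁) * (x₃ - x₁) * (x₃ - x₂)) ^ 2
      + w₁ * w₂ * w₄ * ((x₂ - x₁) * (x₄ - x₁) * (x₄ - x₂)) ^ 2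
      + w₁ * w₂ * w₅ * ((x₂ - x₁) * (x₅ - x₁) * (x₅ - x₂)) ^ 2
      + w₁ * w₃ * w₄ * ((x₃ - x₁) * (x₄ - x₁) * (x₄ - x₃)) ^ 2
      + w₁ * w₃ * w₅ * ((x₃ - x₁) * (x₅ - x₁) * (x₅ - x₃)) ^ 2
      + w₁ * w₄ * w₅ * ((x₄ - x₁) * (x₅ - x₁) * (x₅ - x₄)) ^ 2
      + w₂ * w₃ * w₄ * ((x₃ - x₂) * (x₄ - x₂) * (x₄ - x₃)) ^ 2
      + w₂ * w₃ * w₅ * ((x₃ - x₂) * (x₅ - x₂) * (x₅ - x₃)) ^ 2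
      + w₂ * w₄ * w₅ * ((x₄ - x₂) * (x₅ - x₂) * (x₅ - x₄)) ^ 2
      + w₃ * w₄ * w₅ * ((x₄ - x₃) * (x₅ - x₃) * (x₅ - x₄)) ^ 2)
    = ((w₁ + w₂ + w₃ + w₄ + w₅) * (w₁ * x₁ ^ 2 + w₂ * x₂ ^ 2 + w₃ * x₃ ^ 2 + w₄ * x₄ ^ 2 + w₅ * x₅ ^ 2) * (w₁ * x₁ ^ 4 + w₂ * x₂ ^ 4 + w₃ * x₃ ^ 4 + w₄ * x₄ ^ 4 + w₅ * x₅ ^ 4)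
        - (w₁ + w₂ + w₃ + w₄ + w₅) * (w₁ * x₁ ^ 3 + w₂ * x₂ ^ 3 + w₃ * x₃ ^ 3 + w₄ * x₄ ^ 3 + w₅ * x₅ ^ 3) * (w₁ * x₁ ^ 3 + w₂ * x₂ ^ 3 + w₃ * x₃ ^ 3 + w₄ * x₄ ^ 3 + w₅ * x₅ ^ 3)
        - (w₁ * x₁ + w₂ * x₂ + w₃ * x₃ + w₄ * x₄ + w₅ * x₅) * (w₁ * x₁ + w₂ * x₂ + w₃ * x₃ + w₄ * x₄ + w₅ * x₅) * (w₁ * x₁ ^ 4 + w₂ * x₂ ^ 4 + w₃ * x₃ ^ 4 + w₄ * x₄ ^ 4 + w₅ * x₅ ^ 4)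
        + (w₁ * x₁ + w₂ * x₂ + w₃ * x₃ + w₄ * x₄ + w₅ * x₅) * (w₁ * x₁ ^ 3 + w₂ * x₂ ^ 3 + w₃ * x₃ ^ 3 + w₄ * x₄ ^ 3 + w₅ * x₅ ^ 3) * (w₁ * x₁ ^ 2 + w₂ * x₂ ^ 2 + w₃ * x₃ ^ 2 + w₄ * x₄ ^ 2 + w₅ * x₅ ^ 2)
        + (w₁ * x₁ ^ 2 + w₂ * x₂ ^ 2 + w₃ * x₃ ^ 2 + w₄ * x₄ ^ 2 + w₅ * x₅ ^ 2) * (w₁ * x₁ + w₂ * x₂ + w₃ * x₃ + w₄ * x₄ + w₅ * x₅) * (w₁ * x₁ ^ 3 + w₂ * x₂ ^ 3 + w₃ * x₃ ^ 3 + w₄ * x₄ ^ 3 + w₅ * x₅ ^ 3)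
        - (w₁ * x₁ ^ 2 + w₂ * x₂ ^ 2 + w₃ * x₃ ^ 2 + w₄ * x₄ ^ 2 + w₅ * x₅ ^ 2) * (w₁ * x₁ ^ 2 + w₂ * x₂ ^ 2 + w₃ * x₃ ^ 2 + w₄ * x₄ ^ 2 + w₅ * x₅ ^ 2) * (w₁ * x₁ ^ 2 + w₂ * x₂ ^ 2 + w₃ * x₃ ^ 2 + w₄ * x₄ ^ 2 + w₅ * x₅ ^ 2)) := by
  ring

/-- `in₂(1) = w₁ · t₀`, `t₀ = Σ_j w_j (x₁ - x_j)²`.  [folklore] -/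
theorem hankelIn₅_two (x₁ x₂ x₃ x₄ x₅ w₁ w₂ w₃ w₄ w₅ : ℝ) :
    (w₁ * w₂ * ((x₂ - x₁)) ^ 2 + w₁ * w₃ * ((x₃ - x₁)) ^ 2 + w₁ * w₄ * ((x₄ - x₁)) ^ 2
      + w₁ * w₅ * ((x₅ - x₁)) ^ 2)
    = w₁ * (w₂ * (x₁ - x₂) ^ 2 + w₃ * (x₁ - x₃) ^ 2 + w₄ * (x₁ - x₄) ^ 2 + w₅ * (x₁ - x₅) ^ 2) := by
  ring

/-- Cauchy–Binet for the Christoffel-modified weights, `k = 3`: `in₃(1) = w₁ · (t₀ t₂ - t₁²)`,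
`t_a = Σ_j w_j x_j^a (x₁ - x_j)²`.  [folklore] -/
theorem hankelIn₅_three (x₁ x₂ x₃ x₄ x₅ w₁ w₂ w₃ w₄ w₅ : ℝ) :
    (w₁ * w₂ * w₃ * ((x₂ - x₁) * (x₃ - x₁) * (x₃ - x₂)) ^ 2
      + w₁ * w₂ * w₄ * ((x₂ - x₁) * (x₄ - x₁) * (x₄ - x₂)) ^ 2
      + w₁ * w₂ * w₅ * ((x₂ - x₁) * (x₅ - x₁) * (x₅ - x₂)) ^ 2
      + w₁ * w₃ * w₄ * ((x₃ - x₁) * (x₄ - x₁) * (x₄ - x₃)) ^ 2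
      + w₁ * w₃ * w₅ * ((x₃ - x₁) * (x₅ - x₁) * (x₅ - x₃)) ^ 2
      + w₁ * w₄ * w₅ * ((x₄ - x₁) * (x₅ - x₁) * (x₅ - x₄)) ^ 2)
    = w₁ * ((w₂ * (x₁ - x₂) ^ 2 + w₃ * (x₁ - x₃) ^ 2 + w₄ * (x₁ - x₄) ^ 2 + w₅ * (x₁ - x₅) ^ 2) * (w₂ * x₂ ^ 2 * (x₁ - x₂) ^ 2 + w₃ * x₃ ^ 2 * (x₁ - x₃) ^ 2 + w₄ * x₄ ^ 2 * (x₁ - x₄) ^ 2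
      + w₅ * x₅ ^ 2 * (x₁ - x₅) ^ 2)
        - (w₂ * x₂ * (x₁ - x₂) ^ 2 + w₃ * x₃ * (x₁ - x₃) ^ 2 + w₄ * x₄ * (x₁ - x₄) ^ 2
      + w₅ * x₅ * (x₁ - x₅) ^ 2) * (w₂ * x₂ * (x₁ - x₂) ^ 2 + w₃ * x₃ * (x₁ - x₃) ^ 2 + w₄ * x₄ * (x₁ - x₄) ^ 2
      + w₅ * x₅ * (x₁ - x₅) ^ 2)) := by
  ring

/-- The alternating Vandermonde identity for five points: `Σ_i (-1)^(i+1) Δ(x_(-i)) = 0` (expansion of a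
determinant with two equal rows).  [folklore] -/
theorem vandermonde_alt₅ (x₁ x₂ x₃ x₄ x₅ : ℝ) :
    ((x₃ - x₂) * (x₄ - x₂) * (x₅ - x₂) * (x₄ - x₃) * (x₅ - x₃) * (x₅ - x₄))
      - ((x₃ - x₁) * (x₄ - x₁) * (x₅ - x₁) * (x₄ - x₃) * (x₅ - x₃) * (x₅ - x₄))
      + ((x₂ - x₁) * (x₄ - x₁) * (x₅ - x₁) * (x₄ - x₂) * (x₅ - x₂) * (x₅ - x₄))
      - ((x₂ - x₁) * (x₃ - x₁) * (x₅ - x₁) * (x₃ - x₂) * (x₅ - x₂) * (x₅ - x₃))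
      + ((x₂ - x₁) * (x₃ - x₁) * (x₄ - x₁) * (x₃ - x₂) * (x₄ - x₂) * (x₄ - x₃)) = 0 := by
  ring

/-- Weighted Cauchy–Schwarz with cleared denominators, four terms, as an identity.  [folklore] -/
theorem weightedCS_four_eq (a b c d p q r s : ℝ) :
    (p + q + r + s) * (p * q * r * d ^ 2 + p * q * s * c ^ 2 + p * r * s * b ^ 2 + q * r * s * a ^ 2)
      - p * q * r * s * (a - b + c - d) ^ 2
    = r * s * (q * a + p * b) ^ 2 + q * s * (r * a - p * c) ^ 2 + q * r * (s * a + p * d) ^ 2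
      + p * s * (r * b + q * c) ^ 2 + p * r * (q * d - s * b) ^ 2 + p * q * (s * c + r * d) ^ 2 := by
  ring

/-- Weighted Cauchy–Schwarz, four terms: `pqrs (a-b+c-d)² ≤ (p+q+r+s)(pqr d² + pqs c² + prs b² + qrs a²)`
for nonnegative weights.  [folklore] -/
theorem weightedCS_four_le (a b c d p q r s : ℝ) (hp : 0 ≤ p) (hq : 0 ≤ q) (hr : 0 ≤ r)
    (hs : 0 ≤ s) :
    p * q * r * s * (a - b + c - d) ^ 2
      ≤ (p + q + r + s) * (p * q * r * d ^ 2 + p * q * s * c ^ 2 + p * r * s * b ^ 2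
          + q * r * s * a ^ 2) := by
  have h := weightedCS_four_eq a b c d p q r s
  have h1 : 0 ≤ r * s * (q * a + p * b) ^ 2 := by positivity
  have h2 : 0 ≤ q * s * (r * a - p * c) ^ 2 := by positivity
  have h3 : 0 ≤ q * r * (s * a + p * d) ^ 2 := by positivity
  have h4 : 0 ≤ p * s * (r * b + q * c) ^ 2 := by positivity
  have h5 : 0 ≤ p * r * (q * d - s * b) ^ 2 := by positivity
  have h6 : 0 ≤ p * q * (s * c + r * d) ^ 2 := by positivity
  linarith

/-- EXCHANGE INEQUALITY (E1) of Lemma G.19 at `n = 5`, `k = 4`, level `1`, in the `w₁`-free form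
`out₄(1) ≤ (w₂+w₃+w₄+w₅) · in₄(1)/w₁`.  [folklore] -/
theorem exchange_four (x₁ x₂ x₃ x₄ x₅ w₂ w₃ w₄ w₅ : ℝ) (hw₂ : 0 ≤ w₂) (hw₃ : 0 ≤ w₃)
    (hw₄ : 0 ≤ w₄) (hw₅ : 0 ≤ w₅) :
    (w₂ * w₃ * w₄ * w₅ * ((x₃ - x₂) * (x₄ - x₂) * (x₅ - x₂) * (x₄ - x₃) * (x₅ - x₃) * (x₅ - x₄)) ^ 2)
      ≤ (w₂ + w₃ + w₄ + w₅)
        * (w₂ * w₃ * w₄ * ((x₂ - x₁) * (x₃ - x₁) * (x₄ - x₁) * (x₃ - x₂) * (x₄ - x₂) * (x₄ - x₃)) ^ 2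
      + w₂ * w₃ * w₅ * ((x₂ - x₁) * (x₃ - x₁) * (x₅ - x₁) * (x₃ - x₂) * (x₅ - x₂) * (x₅ - x₃)) ^ 2
      + w₂ * w₄ * w₅ * ((x₂ - x₁) * (x₄ - x₁) * (x₅ - x₁) * (x₄ - x₂) * (x₅ - x₂) * (x₅ - x₄)) ^ 2
      + w₃ * w₄ * w₅ * ((x₃ - x₁) * (x₄ - x₁) * (x₅ - x₁) * (x₄ - x₃) * (x₅ - x₃) * (x₅ - x₄)) ^ 2) := by
  have alt := vandermonde_alt₅ x₁ x₂ x₃ x₄ x₅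
  have key := weightedCS_four_le ((x₃ - x₁) * (x₄ - x₁) * (x₅ - x₁) * (x₄ - x₃) * (x₅ - x₃) * (x₅ - x₄)) ((x₂ - x₁) * (x₄ - x₁) * (x₅ - x₁) * (x₄ - x₂) * (x₅ - x₂) * (x₅ - x₄))
    ((x₂ - x₁) * (x₃ - x₁) * (x₅ - x₁) * (x₃ - x₂) * (x₅ - x₂) * (x₅ - x₃)) ((x₂ - x₁) * (x₃ - x₁) * (x₄ - x₁) * (x₃ - x₂) * (x₄ - x₂) * (x₄ - x₃)) w₂ w₃ w₄ w₅ hw₂ hw₃ hw₄ hw₅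
  have e : ((x₃ - x₂) * (x₄ - x₂) * (x₅ - x₂) * (x₄ - x₃) * (x₅ - x₃) * (x₅ - x₄))
      = ((x₃ - x₁) * (x₄ - x₁) * (x₅ - x₁) * (x₄ - x₃) * (x₅ - x₃) * (x₅ - x₄)) - ((x₂ - x₁) * (x₄ - x₁) * (x₅ - x₁) * (x₄ - x₂) * (x₅ - x₂) * (x₅ - x₄))
        + ((x₂ - x₁) * (x₃ - x₁) * (x₅ - x₁) * (x₃ - x₂) * (x₅ - x₂) * (x₅ - x₃)) - ((x₂ - x₁) * (x₃ - x₁) * (x₄ - x₁) * (x₃ - x₂) * (x₄ - x₂) * (x₄ - x₃)) := by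
    linarith [alt]
  rw [e]
  exact key

/-- Arithmetic skeleton of the monotonicity chain `in₁/D₁ ≤ in₂/D₂ ≤ in₃/D₃` (two Christoffel steps,
cleared denominators).  [folklore] -/
theorem letters_aux (S0 W A B T0 T2 Q1sq Q2sq : ℝ) (hS : 0 < S0) (hW : 0 < W) (hA : 0 < A)
    (hB : 0 ≤ B) (hWT2 : 0 ≤ W * T2) (hQ1 : 0 ≤ Q1sq) (hQ2 : 0 ≤ Q2sq)
    (F1 : S0 * T0 - A * 1 = Q1sq) (F2 : A * T2 - B * T0 = Q2sq) :
    W * A ≤ S0 * (W * T0) ∧ W * B ≤ S0 * (W * T2) := by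
  have hT2 : 0 ≤ T2 := (mul_nonneg_iff_of_pos_left hW).mp hWT2
  have step2 : A ≤ S0 * T0 := by linarith
  constructor
  · have h := mul_le_mul_of_nonneg_left step2 hW.le
    linarith
  · have B1 := mul_le_mul_of_nonneg_left step2 hB
    have A1 : B * T0 ≤ A * T2 := by linarith
    have C1 := mul_le_mul_of_nonneg_left A1 hS.le
    have key : A * B ≤ A * (S0 * T2) := by linarith
    have fin : B ≤ S0 * T2 := le_of_mul_le_mul_left key hA
    have h := mul_le_mul_of_nonneg_left fin hW.le
    linarith

set_option maxHeartbeats 800000 in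
/-- INCLUSION ≥ WEIGHT at five levels (G.27(a),(b): `in_k(1)/D_k ≥ in₁(1)/D₁ = w₁/s₀`) for `k = 2, 3`,
and the top letter `k = 4` in exchange form (G.19 (E1)): for positive weights and `x₁ ≠ x₂`,
`w₁·D₂ ≤ s₀·in₂(1)`, `w₁·D₃ ≤ s₀·in₃(1)`, `w₁·out₄(1) ≤ (s₀ - w₁)·in₄(1)`.  [folklore] -/
theorem letters₅ (x₁ x₂ x₃ x₄ x₅ w₁ w₂ w₃ w₄ w₅ : ℝ) (hw₁ : 0 < w₁) (hw₂ : 0 < w₂) (hw₃ : 0 < w₃)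
    (hw₄ : 0 < w₄) (hw₅ : 0 < w₅) (hx : x₁ ≠ x₂) :
    w₁ * (w₁ * w₂ * ((x₂ - x₁)) ^ 2 + w₁ * w₃ * ((x₃ - x₁)) ^ 2 + w₁ * w₄ * ((x₄ - x₁)) ^ 2
      + w₁ * w₅ * ((x₅ - x₁)) ^ 2 + w₂ * w₃ * ((x₃ - x₂)) ^ 2 + w₂ * w₄ * ((x₄ - x₂)) ^ 2
      + w₂ * w₅ * ((x₅ - x₂)) ^ 2 + w₃ * w₄ * ((x₄ - x₃)) ^ 2 + w₃ * w₅ * ((x₅ - x₃)) ^ 2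
      + w₄ * w₅ * ((x₅ - x₄)) ^ 2)
      ≤ (w₁ + w₂ + w₃ + w₄ + w₅) * (w₁ * w₂ * ((x₂ - x₁)) ^ 2 + w₁ * w₃ * ((x₃ - x₁)) ^ 2 + w₁ * w₄ * ((x₄ - x₁)) ^ 2
      + w₁ * w₅ * ((x₅ - x₁)) ^ 2)
    ∧ w₁ * (w₁ * w₂ * w₃ * ((x₂ - x₁) * (x₃ - x₁) * (x₃ - x₂)) ^ 2
      + w₁ * w₂ * w₄ * ((x₂ - x₁) * (x₄ - x₁) * (x₄ - x₂)) ^ 2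
      + w₁ * w₂ * w₅ * ((x₂ - x₁) * (x₅ - x₁) * (x₅ - x₂)) ^ 2
      + w₁ * w₃ * w₄ * ((x₃ - x₁) * (x₄ - x₁) * (x₄ - x₃)) ^ 2
      + w₁ * w₃ * w₅ * ((x₃ - x₁) * (x₅ - x₁) * (x₅ - x₃)) ^ 2
      + w₁ * w₄ * w₅ * ((x₄ - x₁) * (x₅ - x₁) * (x₅ - x₄)) ^ 2
      + w₂ * w₃ * w₄ * ((x₃ - x₂) * (x₄ - x₂) * (x₄ - x₃)) ^ 2
      + w₂ * w₃ * w₅ * ((x₃ - x₂) * (x₅ - x₂) * (x₅ - x₃)) ^ 2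
      + w₂ * w₄ * w₅ * ((x₄ - x₂) * (x₅ - x₂) * (x₅ - x₄)) ^ 2
      + w₃ * w₄ * w₅ * ((x₄ - x₃) * (x₅ - x₃) * (x₅ - x₄)) ^ 2)
      ≤ (w₁ + w₂ + w₃ + w₄ + w₅) * (w₁ * w₂ * w₃ * ((x₂ - x₁) * (x₃ - x₁) * (x₃ - x₂)) ^ 2
      + w₁ * w₂ * w₄ * ((x₂ - x₁) * (x₄ - x₁) * (x₄ - x₂)) ^ 2
      + w₁ * w₂ * w₅ * ((x₂ - x₁) * (x₅ - x₁) * (x₅ - x₂)) ^ 2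
      + w₁ * w₃ * w₄ * ((x₃ - x₁) * (x₄ - x₁) * (x₄ - x₃)) ^ 2
      + w₁ * w₃ * w₅ * ((x₃ - x₁) * (x₅ - x₁) * (x₅ - x₃)) ^ 2
      + w₁ * w₄ * w₅ * ((x₄ - x₁) * (x₅ - x₁) * (x₅ - x₄)) ^ 2)
    ∧ w₁ * (w₂ * w₃ * w₄ * w₅ * ((x₃ - x₂) * (x₄ - x₂) * (x₅ - x₂) * (x₄ - x₃) * (x₅ - x₃) * (x₅ - x₄)) ^ 2)
      ≤ (w₂ + w₃ + w₄ + w₅) * (w₁ * w₂ * w₃ * w₄ * ((x₂ - x₁) * (x₃ - x₁) * (x₄ - x₁) * (x₃ - x₂) * (x₄ - x₂) * (x₄ - x₃)) ^ 2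
      + w₁ * w₂ * w₃ * w₅ * ((x₂ - x₁) * (x₃ - x₁) * (x₅ - x₁) * (x₃ - x₂) * (x₅ - x₂) * (x₅ - x₃)) ^ 2
      + w₁ * w₂ * w₄ * w₅ * ((x₂ - x₁) * (x₄ - x₁) * (x₅ - x₁) * (x₄ - x₂) * (x₅ - x₂) * (x₅ - x₄)) ^ 2
      + w₁ * w₃ * w₄ * w₅ * ((x₃ - x₁) * (x₄ - x₁) * (x₅ - x₁) * (x₄ - x₃) * (x₅ - x₃) * (x₅ - x₄)) ^ 2) := by
  have eD2 := hankelD₅_two x₁ x₂ x₃ x₄ x₅ w₁ w₂ w₃ w₄ w₅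
  have eD3 := hankelD₅_three x₁ x₂ x₃ x₄ x₅ w₁ w₂ w₃ w₄ w₅
  have eI2 := hankelIn₅_two x₁ x₂ x₃ x₄ x₅ w₁ w₂ w₃ w₄ w₅
  have eI3 := hankelIn₅_three x₁ x₂ x₃ x₄ x₅ w₁ w₂ w₃ w₄ w₅
  have F1 := christoffelStep_one (w₁ + w₂ + w₃ + w₄ + w₅) (w₁ * x₁ + w₂ * x₂ + w₃ * x₃ + w₄ * x₄ + w₅ * x₅)
    (w₁ * x₁ ^ 2 + w₂ * x₂ ^ 2 + w₃ * x₃ ^ 2 + w₄ * x₄ ^ 2 + w₅ * x₅ ^ 2) x₁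
  have F2 := christoffelStep_two (w₁ + w₂ + w₃ + w₄ + w₅) (w₁ * x₁ + w₂ * x₂ + w₃ * x₃ + w₄ * x₄ + w₅ * x₅)
    (w₁ * x₁ ^ 2 + w₂ * x₂ ^ 2 + w₃ * x₃ ^ 2 + w₄ * x₄ ^ 2 + w₅ * x₅ ^ 2) (w₁ * x₁ ^ 3 + w₂ * x₂ ^ 3 + w₃ * x₃ ^ 3 + w₄ * x₄ ^ 3 + w₅ * x₅ ^ 3)
    (w₁ * x₁ ^ 4 + w₂ * x₂ ^ 4 + w₃ * x₃ ^ 4 + w₄ * x₄ ^ 4 + w₅ * x₅ ^ 4) x₁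
  have et0 : x₁ ^ 2 * (w₁ + w₂ + w₃ + w₄ + w₅) - 2 * x₁ * (w₁ * x₁ + w₂ * x₂ + w₃ * x₃ + w₄ * x₄ + w₅ * x₅)
      + (w₁ * x₁ ^ 2 + w₂ * x₂ ^ 2 + w₃ * x₃ ^ 2 + w₄ * x₄ ^ 2 + w₅ * x₅ ^ 2)
      = (w₂ * (x₁ - x₂) ^ 2 + w₃ * (x₁ - x₃) ^ 2 + w₄ * (x₁ - x₄) ^ 2 + w₅ * (x₁ - x₅) ^ 2) := by ring
  have et1 : x₁ ^ 2 * (w₁ * x₁ + w₂ * x₂ + w₃ * x₃ + w₄ * x₄ + w₅ * x₅) - 2 * x₁ * (w₁ * x₁ ^ 2 + w₂ * x₂ ^ 2 + w₃ * x₃ ^ 2 + w₄ * x₄ ^ 2 + w₅ * x₅ ^ 2)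
      + (w₁ * x₁ ^ 3 + w₂ * x₂ ^ 3 + w₃ * x₃ ^ 3 + w₄ * x₄ ^ 3 + w₅ * x₅ ^ 3)
      = (w₂ * x₂ * (x₁ - x₂) ^ 2 + w₃ * x₃ * (x₁ - x₃) ^ 2 + w₄ * x₄ * (x₁ - x₄) ^ 2
      + w₅ * x₅ * (x₁ - x₅) ^ 2) := by ring
  have et2 : x₁ ^ 2 * (w₁ * x₁ ^ 2 + w₂ * x₂ ^ 2 + w₃ * x₃ ^ 2 + w₄ * x₄ ^ 2 + w₅ * x₅ ^ 2) - 2 * x₁ * (w₁ * x₁ ^ 3 + w₂ * x₂ ^ 3 + w₃ * x₃ ^ 3 + w₄ * x₄ ^ 3 + w₅ * x₅ ^ 3)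
      + (w₁ * x₁ ^ 4 + w₂ * x₂ ^ 4 + w₃ * x₃ ^ 4 + w₄ * x₄ ^ 4 + w₅ * x₅ ^ 4)
      = (w₂ * x₂ ^ 2 * (x₁ - x₂) ^ 2 + w₃ * x₃ ^ 2 * (x₁ - x₃) ^ 2 + w₄ * x₄ ^ 2 * (x₁ - x₄) ^ 2
      + w₅ * x₅ ^ 2 * (x₁ - x₅) ^ 2) := by ring
  rw [et0] at F1
  rw [et0, et1, et2] at F2
  have hs0 : 0 < (w₁ + w₂ + w₃ + w₄ + w₅) := by positivity
  have hD2pos : 0 < (w₁ * w₂ * ((x₂ - x₁)) ^ 2 + w₁ * w₃ * ((x₃ - x₁)) ^ 2 + w₁ * w₄ * ((x₄ - x₁)) ^ 2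
      + w₁ * w₅ * ((x₅ - x₁)) ^ 2 + w₂ * w₃ * ((x₃ - x₂)) ^ 2 + w₂ * w₄ * ((x₄ - x₂)) ^ 2
      + w₂ * w₅ * ((x₅ - x₂)) ^ 2 + w₃ * w₄ * ((x₄ - x₃)) ^ 2 + w₃ * w₅ * ((x₅ - x₃)) ^ 2
      + w₄ * w₅ * ((x₅ - x₄)) ^ 2) := by
    have hne : x₂ - x₁ ≠ 0 := sub_ne_zero.mpr (Ne.symm hx)
    have h1 : 0 < w₁ * w₂ * ((x₂ - x₁)) ^ 2 := by positivity
    have h2 : 0 ≤ (w₁ * w₃ * ((x₃ - x₁)) ^ 2 + w₁ * w₄ * ((x₄ - x₁)) ^ 2 + w₁ * w₅ * ((x₅ - x₁)) ^ 2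
      + w₂ * w₃ * ((x₃ - x₂)) ^ 2 + w₂ * w₄ * ((x₄ - x₂)) ^ 2 + w₂ * w₅ * ((x₅ - x₂)) ^ 2
      + w₃ * w₄ * ((x₄ - x₃)) ^ 2 + w₃ * w₅ * ((x₅ - x₃)) ^ 2 + w₄ * w₅ * ((x₅ - x₄)) ^ 2) := by positivity
    linarith only [h1, h2]
  rw [eD2] at hD2pos
  have hD3nn : 0 ≤ (w₁ * w₂ * w₃ * ((x₂ - x₁) * (x₃ - x₁) * (x₃ - x₂)) ^ 2
      + w₁ * w₂ * w₄ * ((x₂ - x₁) * (x₄ - x₁) * (x₄ - x₂)) ^ 2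
      + w₁ * w₂ * w₅ * ((x₂ - x₁) * (x₅ - x₁) * (x₅ - x₂)) ^ 2
      + w₁ * w₃ * w₄ * ((x₃ - x₁) * (x₄ - x₁) * (x₄ - x₃)) ^ 2
      + w₁ * w₃ * w₅ * ((x₃ - x₁) * (x₅ - x₁) * (x₅ - x₃)) ^ 2
      + w₁ * w₄ * w₅ * ((x₄ - x₁) * (x₅ - x₁) * (x₅ - x₄)) ^ 2
      + w₂ * w₃ * w₄ * ((x₃ - x₂) * (x₄ - x₂) * (x₄ - x₃)) ^ 2
      + w₂ * w₃ * w₅ * ((x₃ - x₂) * (x₅ - x₂) * (x₅ - x₃)) ^ 2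
      + w₂ * w₄ * w₅ * ((x₄ - x₂) * (x₅ - x₂) * (x₅ - x₄)) ^ 2
      + w₃ * w₄ * w₅ * ((x₄ - x₃) * (x₅ - x₃) * (x₅ - x₄)) ^ 2) := by positivity
  rw [eD3] at hD3nn
  have hin3 : 0 ≤ (w₁ * w₂ * w₃ * ((x₂ - x₁) * (x₃ - x₁) * (x₃ - x₂)) ^ 2
      + w₁ * w₂ * w₄ * ((x₂ - x₁) * (x₄ - x₁) * (x₄ - x₂)) ^ 2
      + w₁ * w₂ * w₅ * ((x₂ - x₁) * (x₅ - x₁) * (x₅ - x₂)) ^ 2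
      + w₁ * w₃ * w₄ * ((x₃ - x₁) * (x₄ - x₁) * (x₄ - x₃)) ^ 2
      + w₁ * w₃ * w₅ * ((x₃ - x₁) * (x₅ - x₁) * (x₅ - x₃)) ^ 2
      + w₁ * w₄ * w₅ * ((x₄ - x₁) * (x₅ - x₁) * (x₅ - x₄)) ^ 2) := by positivity
  rw [eI3] at hin3
  obtain ⟨h2, h3⟩ := letters_aux _ _ _ _ _ _ _ _ hs0 hw₁ hD2pos hD3nn hin3 (sq_nonneg _) (sq_nonneg _)
    F1 F2
  refine ⟨?_, ?_, ?_⟩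
  · rw [eD2, eI2]; exact h2
  · rw [eD3, eI3]; exact h3
  · have ex := exchange_four x₁ x₂ x₃ x₄ x₅ w₂ w₃ w₄ w₅ hw₂.le hw₃.le hw₄.le hw₅.le
    have h := mul_le_mul_of_nonneg_left ex hw₁.le
    have e : w₁ * ((w₂ + w₃ + w₄ + w₅)
        * (w₂ * w₃ * w₄ * ((x₂ - x₁) * (x₃ - x₁) * (x₄ - x₁) * (x₃ - x₂) * (x₄ - x₂) * (x₄ - x₃)) ^ 2
      + w₂ * w₃ * w₅ * ((x₂ - x₁) * (x₃ - x₁) * (x₅ - x₁) * (x₃ - x₂) * (x₅ - x₂) * (x₅ - x₃)) ^ 2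
      + w₂ * w₄ * w₅ * ((x₂ - x₁) * (x₄ - x₁) * (x₅ - x₁) * (x₄ - x₂) * (x₅ - x₂) * (x₅ - x₄)) ^ 2
      + w₃ * w₄ * w₅ * ((x₃ - x₁) * (x₄ - x₁) * (x₅ - x₁) * (x₄ - x₃) * (x₅ - x₃) * (x₅ - x₄)) ^ 2))
        = (w₂ + w₃ + w₄ + w₅) * (w₁ * w₂ * w₃ * w₄ * ((x₂ - x₁) * (x₃ - x₁) * (x₄ - x₁) * (x₃ - x₂) * (x₄ - x₂) * (x₄ - x₃)) ^ 2
      + w₁ * w₂ * w₃ * w₅ * ((x₂ - x₁) * (x₃ - x₁) * (x₅ - x₁) * (x₃ - x₂) * (x₅ - x₂) * (x₅ - x₃)) ^ 2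
      + w₁ * w₂ * w₄ * w₅ * ((x₂ - x₁) * (x₄ - x₁) * (x₅ - x₁) * (x₄ - x₂) * (x₅ - x₂) * (x₅ - x₄)) ^ 2
      + w₁ * w₃ * w₄ * w₅ * ((x₃ - x₁) * (x₄ - x₁) * (x₅ - x₁) * (x₄ - x₃) * (x₅ - x₃) * (x₅ - x₄)) ^ 2) := by
      ring
    rw [e] at h
    exact h

/-- Arithmetic skeleton of one case of the cover lemma: from `w_m ≥ 1/5`, inclusion ≥ weight at
`k = 2, 3` and the exchange form of the top letter, the three letters `out_k ≤ 4 · in_k`.  [folklore] -/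
theorem cover_case (wm I2 O2 I3 O3 I4 O4 : ℝ) (hwm : 0 < wm) (hm : 1 / 5 ≤ wm)
    (h2 : 0 ≤ I2 + O2) (h3 : 0 ≤ I3 + O3) (h4 : 0 ≤ I4)
    (L1 : wm * (I2 + O2) ≤ 1 * I2) (L2 : wm * (I3 + O3) ≤ 1 * I3)
    (L3 : wm * O4 ≤ (1 - wm) * I4) :
    O2 ≤ 4 * I2 ∧ O3 ≤ 4 * I3 ∧ O4 ≤ 4 * I4 := by
  have P2 := mul_nonneg (sub_nonneg.mpr hm) h2
  have P3 := mul_nonneg (sub_nonneg.mpr hm) h3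
  have P4 : 0 ≤ (5 * wm - 1) * I4 := mul_nonneg (by linarith) h4
  refine ⟨by linarith, by linarith, ?_⟩
  have Q : wm * O4 ≤ wm * (4 * I4) := by linarith
  exact le_of_mul_le_mul_left Q hwm

set_option maxHeartbeats 1600000 in
/-- COVER LEMMA G.28 at `n = 5` (all-β form, `(δ, θ) = (1/5, 1/4)`): for strictly increasing levels and
weights in the open simplex, some level `m` has `w_m ≥ 1/5` and `out_k(m) ≤ 4 · in_k(m)` for
`k = 2, 3, 4` — i.e. the open simplex is covered by the five pieces `B_m(1/5, 1/4)` of Lemma G.18, which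
gives `𝒰₅ ≤ 5 · 5³ · 5^(3/2) · 𝒰₄` (Theorem G.29 at `n = 5`).  [folklore] -/
theorem coverB_five (x₁ x₂ x₃ x₄ x₅ w₁ w₂ w₃ w₄ w₅ : ℝ) (hw₁ : 0 < w₁) (hw₂ : 0 < w₂) (hw₃ : 0 < w₃)
    (hw₄ : 0 < w₄) (hw₅ : 0 < w₅) (hs : w₁ + w₂ + w₃ + w₄ + w₅ = 1) (h12 : x₁ < x₂)
    (h23 : x₂ < x₃) (h34 : x₃ < x₄) (h45 : x₄ < x₅) :
    (1 / 5 ≤ w₁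
      ∧ (w₂ * w₃ * ((x₃ - x₂)) ^ 2 + w₂ * w₄ * ((x₄ - x₂)) ^ 2 + w₂ * w₅ * ((x₅ - x₂)) ^ 2
      + w₃ * w₄ * ((x₄ - x₃)) ^ 2 + w₃ * w₅ * ((x₅ - x₃)) ^ 2 + w₄ * w₅ * ((x₅ - x₄)) ^ 2)
        ≤ 4 * (w₁ * w₂ * ((x₂ - x₁)) ^ 2 + w₁ * w₃ * ((x₃ - x₁)) ^ 2 + w₁ * w₄ * ((x₄ - x₁)) ^ 2
      + w₁ * w₅ * ((x₅ - x₁)) ^ 2)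
      ∧ (w₂ * w₃ * w₄ * ((x₃ - x₂) * (x₄ - x₂) * (x₄ - x₃)) ^ 2
      + w₂ * w₃ * w₅ * ((x₃ - x₂) * (x₅ - x₂) * (x₅ - x₃)) ^ 2
      + w₂ * w₄ * w₅ * ((x₄ - x₂) * (x₅ - x₂) * (x₅ - x₄)) ^ 2
      + w₃ * w₄ * w₅ * ((x₄ - x₃) * (x₅ - x₃) * (x₅ - x₄)) ^ 2)
        ≤ 4 * (w₁ * w₂ * w₃ * ((x₂ - x₁) * (x₃ - x₁) * (x₃ - x₂)) ^ 2
      + w₁ * w₂ * w₄ * ((x₂ - x₁) * (x₄ - x₁) * (x₄ - x₂)) ^ 2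
      + w₁ * w₂ * w₅ * ((x₂ - x₁) * (x₅ - x₁) * (x₅ - x₂)) ^ 2
      + w₁ * w₃ * w₄ * ((x₃ - x₁) * (x₄ - x₁) * (x₄ - x₃)) ^ 2
      + w₁ * w₃ * w₅ * ((x₃ - x₁) * (x₅ - x₁) * (x₅ - x₃)) ^ 2
      + w₁ * w₄ * w₅ * ((x₄ - x₁) * (x₅ - x₁) * (x₅ - x₄)) ^ 2)
      ∧ (w₂ * w₃ * w₄ * w₅ * ((x₃ - x₂) * (x₄ - x₂) * (x₅ - x₂) * (x₄ - x₃) * (x₅ - x₃) * (x₅ - x₄)) ^ 2)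
        ≤ 4 * (w₁ * w₂ * w₃ * w₄ * ((x₂ - x₁) * (x₃ - x₁) * (x₄ - x₁) * (x₃ - x₂) * (x₄ - x₂) * (x₄ - x₃)) ^ 2
      + w₁ * w₂ * w₃ * w₅ * ((x₂ - x₁) * (x₃ - x₁) * (x₅ - x₁) * (x₃ - x₂) * (x₅ - x₂) * (x₅ - x₃)) ^ 2
      + w₁ * w₂ * w₄ * w₅ * ((x₂ - x₁) * (x₄ - x₁) * (x₅ - x₁) * (x₄ - x₂) * (x₅ - x₂) * (x₅ - x₄)) ^ 2
      + w₁ * w₃ * w₄ * w₅ * ((x₃ - x₁) * (x₄ - x₁) * (x₅ - x₁) * (x₄ - x₃) * (x₅ - x₃) * (x₅ - x₄)) ^ 2))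
    ∨ (1 / 5 ≤ w₂
      ∧ (w₁ * w₃ * ((x₃ - x₁)) ^ 2 + w₁ * w₄ * ((x₄ - x₁)) ^ 2 + w₁ * w₅ * ((x₅ - x₁)) ^ 2
      + w₃ * w₄ * ((x₄ - x₃)) ^ 2 + w₃ * w₅ * ((x₅ - x₃)) ^ 2 + w₄ * w₅ * ((x₅ - x₄)) ^ 2)
        ≤ 4 * (w₁ * w₂ * ((x₂ - x₁)) ^ 2 + w₂ * w₃ * ((x₃ - x₂)) ^ 2 + w₂ * w₄ * ((x₄ - x₂)) ^ 2
      + w₂ * w₅ * ((x₅ - x₂)) ^ 2)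
      ∧ (w₁ * w₃ * w₄ * ((x₃ - x₁) * (x₄ - x₁) * (x₄ - x₃)) ^ 2
      + w₁ * w₃ * w₅ * ((x₃ - x₁) * (x₅ - x₁) * (x₅ - x₃)) ^ 2
      + w₁ * w₄ * w₅ * ((x₄ - x₁) * (x₅ - x₁) * (x₅ - x₄)) ^ 2
      + w₃ * w₄ * w₅ * ((x₄ - x₃) * (x₅ - x₃) * (x₅ - x₄)) ^ 2)
        ≤ 4 * (w₁ * w₂ * w₃ * ((x₂ - x₁) * (x₃ - x₁) * (x₃ - x₂)) ^ 2
      + w₁ * w₂ * w₄ * ((x₂ - x₁) * (x₄ - x₁) * (x₄ - x₂)) ^ 2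
      + w₁ * w₂ * w₅ * ((x₂ - x₁) * (x₅ - x₁) * (x₅ - x₂)) ^ 2
      + w₂ * w₃ * w₄ * ((x₃ - x₂) * (x₄ - x₂) * (x₄ - x₃)) ^ 2
      + w₂ * w₃ * w₅ * ((x₃ - x₂) * (x₅ - x₂) * (x₅ - x₃)) ^ 2
      + w₂ * w₄ * w₅ * ((x₄ - x₂) * (x₅ - x₂) * (x₅ - x₄)) ^ 2)
      ∧ (w₁ * w₃ * w₄ * w₅ * ((x₃ - x₁) * (x₄ - x₁) * (x₅ - x₁) * (x₄ - x₃) * (x₅ - x₃) * (x₅ - x₄)) ^ 2)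
        ≤ 4 * (w₁ * w₂ * w₃ * w₄ * ((x₂ - x₁) * (x₃ - x₁) * (x₄ - x₁) * (x₃ - x₂) * (x₄ - x₂) * (x₄ - x₃)) ^ 2
      + w₁ * w₂ * w₃ * w₅ * ((x₂ - x₁) * (x₃ - x₁) * (x₅ - x₁) * (x₃ - x₂) * (x₅ - x₂) * (x₅ - x₃)) ^ 2
      + w₁ * w₂ * w₄ * w₅ * ((x₂ - x₁) * (x₄ - x₁) * (x₅ - x₁) * (x₄ - x₂) * (x₅ - x₂) * (x₅ - x₄)) ^ 2
      + w₂ * w₃ * w₄ * w₅ * ((x₃ - x₂) * (x₄ - x₂) * (x₅ - x₂) * (x₄ - x₃) * (x₅ - x₃) * (x₅ - x₄)) ^ 2))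
    ∨ (1 / 5 ≤ w₃
      ∧ (w₁ * w₂ * ((x₂ - x₁)) ^ 2 + w₁ * w₄ * ((x₄ - x₁)) ^ 2 + w₁ * w₅ * ((x₅ - x₁)) ^ 2
      + w₂ * w₄ * ((x₄ - x₂)) ^ 2 + w₂ * w₅ * ((x₅ - x₂)) ^ 2 + w₄ * w₅ * ((x₅ - x₄)) ^ 2)
        ≤ 4 * (w₁ * w₃ * ((x₃ - x₁)) ^ 2 + w₂ * w₃ * ((x₃ - x₂)) ^ 2 + w₃ * w₄ * ((x₄ - x₃)) ^ 2
      + w₃ * w₅ * ((x₅ - x₃)) ^ 2)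
      ∧ (w₁ * w₂ * w₄ * ((x₂ - x₁) * (x₄ - x₁) * (x₄ - x₂)) ^ 2
      + w₁ * w₂ * w₅ * ((x₂ - x₁) * (x₅ - x₁) * (x₅ - x₂)) ^ 2
      + w₁ * w₄ * w₅ * ((x₄ - x₁) * (x₅ - x₁) * (x₅ - x₄)) ^ 2
      + w₂ * w₄ * w₅ * ((x₄ - x₂) * (x₅ - x₂) * (x₅ - x₄)) ^ 2)
        ≤ 4 * (w₁ * w₂ * w₃ * ((x₂ - x₁) * (x₃ - x₁) * (x₃ - x₂)) ^ 2
      + w₁ * w₃ * w₄ * ((x₃ - x₁) * (x₄ - x₁) * (x₄ - x₃)) ^ 2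
      + w₁ * w₃ * w₅ * ((x₃ - x₁) * (x₅ - x₁) * (x₅ - x₃)) ^ 2
      + w₂ * w₃ * w₄ * ((x₃ - x₂) * (x₄ - x₂) * (x₄ - x₃)) ^ 2
      + w₂ * w₃ * w₅ * ((x₃ - x₂) * (x₅ - x₂) * (x₅ - x₃)) ^ 2
      + w₃ * w₄ * w₅ * ((x₄ - x₃) * (x₅ - x₃) * (x₅ - x₄)) ^ 2)
      ∧ (w₁ * w₂ * w₄ * w₅ * ((x₂ - x₁) * (x₄ - x₁) * (x₅ - x₁) * (x₄ - x₂) * (x₅ - x₂) * (x₅ - x₄)) ^ 2)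
        ≤ 4 * (w₁ * w₂ * w₃ * w₄ * ((x₂ - x₁) * (x₃ - x₁) * (x₄ - x₁) * (x₃ - x₂) * (x₄ - x₂) * (x₄ - x₃)) ^ 2
      + w₁ * w₂ * w₃ * w₅ * ((x₂ - x₁) * (x₃ - x₁) * (x₅ - x₁) * (x₃ - x₂) * (x₅ - x₂) * (x₅ - x₃)) ^ 2
      + w₁ * w₃ * w₄ * w₅ * ((x₃ - x₁) * (x₄ - x₁) * (x₅ - x₁) * (x₄ - x₃) * (x₅ - x₃) * (x₅ - x₄)) ^ 2
      + w₂ * w₃ * w₄ * w₅ * ((x₃ - x₂) * (x₄ - x₂) * (x₅ - x₂) * (x₄ - x₃) * (x₅ - x₃) * (x₅ - x₄)) ^ 2))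
    ∨ (1 / 5 ≤ w₄
      ∧ (w₁ * w₂ * ((x₂ - x₁)) ^ 2 + w₁ * w₃ * ((x₃ - x₁)) ^ 2 + w₁ * w₅ * ((x₅ - x₁)) ^ 2
      + w₂ * w₃ * ((x₃ - x₂)) ^ 2 + w₂ * w₅ * ((x₅ - x₂)) ^ 2 + w₃ * w₅ * ((x₅ - x₃)) ^ 2)
        ≤ 4 * (w₁ * w₄ * ((x₄ - x₁)) ^ 2 + w₂ * w₄ * ((x₄ - x₂)) ^ 2 + w₃ * w₄ * ((x₄ - x₃)) ^ 2
      + w₄ * w₅ * ((x₅ - x₄)) ^ 2)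
      ∧ (w₁ * w₂ * w₃ * ((x₂ - x₁) * (x₃ - x₁) * (x₃ - x₂)) ^ 2
      + w₁ * w₂ * w₅ * ((x₂ - x₁) * (x₅ - x₁) * (x₅ - x₂)) ^ 2
      + w₁ * w₃ * w₅ * ((x₃ - x₁) * (x₅ - x₁) * (x₅ - x₃)) ^ 2
      + w₂ * w₃ * w₅ * ((x₃ - x₂) * (x₅ - x₂) * (x₅ - x₃)) ^ 2)
        ≤ 4 * (w₁ * w₂ * w₄ * ((x₂ - x₁) * (x₄ - x₁) * (x₄ - x₂)) ^ 2
      + w₁ * w₃ * w₄ * ((x₃ - x₁) * (x₄ - x₁) * (x₄ - x₃)) ^ 2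
      + w₁ * w₄ * w₅ * ((x₄ - x₁) * (x₅ - x₁) * (x₅ - x₄)) ^ 2
      + w₂ * w₃ * w₄ * ((x₃ - x₂) * (x₄ - x₂) * (x₄ - x₃)) ^ 2
      + w₂ * w₄ * w₅ * ((x₄ - x₂) * (x₅ - x₂) * (x₅ - x₄)) ^ 2
      + w₃ * w₄ * w₅ * ((x₄ - x₃) * (x₅ - x₃) * (x₅ - x₄)) ^ 2)
      ∧ (w₁ * w₂ * w₃ * w₅ * ((x₂ - x₁) * (x₃ - x₁) * (x₅ - x₁) * (x₃ - x₂) * (x₅ - x₂) * (x₅ - x₃)) ^ 2)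
        ≤ 4 * (w₁ * w₂ * w₃ * w₄ * ((x₂ - x₁) * (x₃ - x₁) * (x₄ - x₁) * (x₃ - x₂) * (x₄ - x₂) * (x₄ - x₃)) ^ 2
      + w₁ * w₂ * w₄ * w₅ * ((x₂ - x₁) * (x₄ - x₁) * (x₅ - x₁) * (x₄ - x₂) * (x₅ - x₂) * (x₅ - x₄)) ^ 2
      + w₁ * w₃ * w₄ * w₅ * ((x₃ - x₁) * (x₄ - x₁) * (x₅ - x₁) * (x₄ - x₃) * (x₅ - x₃) * (x₅ - x₄)) ^ 2
      + w₂ * w₃ * w₄ * w₅ * ((x₃ - x₂) * (x₄ - x₂) * (x₅ - x₂) * (x₄ - x₃) * (x₅ - x₃) * (x₅ - x₄)) ^ 2))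
    ∨ (1 / 5 ≤ w₅
      ∧ (w₁ * w₂ * ((x₂ - x₁)) ^ 2 + w₁ * w₃ * ((x₃ - x₁)) ^ 2 + w₁ * w₄ * ((x₄ - x₁)) ^ 2
      + w₂ * w₃ * ((x₃ - x₂)) ^ 2 + w₂ * w₄ * ((x₄ - x₂)) ^ 2 + w₃ * w₄ * ((x₄ - x₃)) ^ 2)
        ≤ 4 * (w₁ * w₅ * ((x₅ - x₁)) ^ 2 + w₂ * w₅ * ((x₅ - x₂)) ^ 2 + w₃ * w₅ * ((x₅ - x₃)) ^ 2
      + w₄ * w₅ * ((x₅ - x₄)) ^ 2)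
      ∧ (w₁ * w₂ * w₃ * ((x₂ - x₁) * (x₃ - x₁) * (x₃ - x₂)) ^ 2
      + w₁ * w₂ * w₄ * ((x₂ - x₁) * (x₄ - x₁) * (x₄ - x₂)) ^ 2
      + w₁ * w₃ * w₄ * ((x₃ - x₁) * (x₄ - x₁) * (x₄ - x₃)) ^ 2
      + w₂ * w₃ * w₄ * ((x₃ - x₂) * (x₄ - x₂) * (x₄ - x₃)) ^ 2)
        ≤ 4 * (w₁ * w₂ * w₅ * ((x₂ - x₁) * (x₅ - x₁) * (x₅ - x₂)) ^ 2
      + w₁ * w₃ * w₅ * ((x₃ - x₁) * (x₅ - x₁) * (x₅ - x₃)) ^ 2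
      + w₁ * w₄ * w₅ * ((x₄ - x₁) * (x₅ - x₁) * (x₅ - x₄)) ^ 2
      + w₂ * w₃ * w₅ * ((x₃ - x₂) * (x₅ - x₂) * (x₅ - x₃)) ^ 2
      + w₂ * w₄ * w₅ * ((x₄ - x₂) * (x₅ - x₂) * (x₅ - x₄)) ^ 2
      + w₃ * w₄ * w₅ * ((x₄ - x₃) * (x₅ - x₃) * (x₅ - x₄)) ^ 2)
      ∧ (w₁ * w₂ * w₃ * w₄ * ((x₂ - x₁) * (x₃ - x₁) * (x₄ - x₁) * (x₃ - x₂) * (x₄ - x₂) * (x₄ - x₃)) ^ 2)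
        ≤ 4 * (w₁ * w₂ * w₃ * w₅ * ((x₂ - x₁) * (x₃ - x₁) * (x₅ - x₁) * (x₃ - x₂) * (x₅ - x₂) * (x₅ - x₃)) ^ 2
      + w₁ * w₂ * w₄ * w₅ * ((x₂ - x₁) * (x₄ - x₁) * (x₅ - x₁) * (x₄ - x₂) * (x₅ - x₂) * (x₅ - x₄)) ^ 2
      + w₁ * w₃ * w₄ * w₅ * ((x₃ - x₁) * (x₄ - x₁) * (x₅ - x₁) * (x₄ - x₃) * (x₅ - x₃) * (x₅ - x₄)) ^ 2
      + w₂ * w₃ * w₄ * w₅ * ((x₃ - x₂) * (x₄ - x₂) * (x₅ - x₂) * (x₄ - x₃) * (x₅ - x₃) * (x₅ - x₄)) ^ 2)) := by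
  have pig : 1 / 5 ≤ w₁ ∨ 1 / 5 ≤ w₂ ∨ 1 / 5 ≤ w₃ ∨ 1 / 5 ≤ w₄ ∨ 1 / 5 ≤ w₅ := by
    by_contra h
    simp only [not_or, not_le] at h
    obtain ⟨h1, h2, h3, h4, h5⟩ := h
    linarith only [h1, h2, h3, h4, h5, hs]
  rcases pig with hm | hm | hm | hm | hm
  · -- level 1
    have hS : (w₁ + w₂ + w₃ + w₄ + w₅) = 1 := by linarith only [hs]
    have hO : w₂ + w₃ + w₄ + w₅ = 1 - w₁ := by linarith only [hs]
    have L := letters₅ x₁ x₂ x₃ x₄ x₅ w₁ w₂ w₃ w₄ w₅ hw₁ hw₂ hw₃ hw₄ hw₅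
      (ne_of_lt h12)
    obtain ⟨L1, L2, L3⟩ := L
    rw [hS] at L1 L2
    have c2 : (w₁ * w₂ * ((x₂ - x₁)) ^ 2 + w₁ * w₃ * ((x₃ - x₁)) ^ 2 + w₁ * w₄ * ((x₄ - x₁)) ^ 2
      + w₁ * w₅ * ((x₅ - x₁)) ^ 2 + w₂ * w₃ * ((x₃ - x₂)) ^ 2 + w₂ * w₄ * ((x₄ - x₂)) ^ 2
      + w₂ * w₅ * ((x₅ - x₂)) ^ 2 + w₃ * w₄ * ((x₄ - x₃)) ^ 2 + w₃ * w₅ * ((x₅ - x₃)) ^ 2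
      + w₄ * w₅ * ((x₅ - x₄)) ^ 2)
        = (w₁ * w₂ * ((x₂ - x₁)) ^ 2 + w₁ * w₃ * ((x₃ - x₁)) ^ 2 + w₁ * w₄ * ((x₄ - x₁)) ^ 2
      + w₁ * w₅ * ((x₅ - x₁)) ^ 2)
          + (w₂ * w₃ * ((x₃ - x₂)) ^ 2 + w₂ * w₄ * ((x₄ - x₂)) ^ 2 + w₂ * w₅ * ((x₅ - x₂)) ^ 2
      + w₃ * w₄ * ((x₄ - x₃)) ^ 2 + w₃ * w₅ * ((x₅ - x₃)) ^ 2 + w₄ * w₅ * ((x₅ - x₄)) ^ 2) := by ring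
    have i2 : (w₁ * w₂ * ((x₂ - x₁)) ^ 2 + w₁ * w₃ * ((x₃ - x₁)) ^ 2 + w₁ * w₄ * ((x₄ - x₁)) ^ 2
      + w₁ * w₅ * ((x₅ - x₁)) ^ 2)
        = (w₁ * w₂ * ((x₂ - x₁)) ^ 2 + w₁ * w₃ * ((x₃ - x₁)) ^ 2 + w₁ * w₄ * ((x₄ - x₁)) ^ 2
      + w₁ * w₅ * ((x₅ - x₁)) ^ 2) := by ring
    have c3 : (w₁ * w₂ * w₃ * ((x₂ - x₁) * (x₃ - x₁) * (x₃ - x₂)) ^ 2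
      + w₁ * w₂ * w₄ * ((x₂ - x₁) * (x₄ - x₁) * (x₄ - x₂)) ^ 2
      + w₁ * w₂ * w₅ * ((x₂ - x₁) * (x₅ - x₁) * (x₅ - x₂)) ^ 2
      + w₁ * w₃ * w₄ * ((x₃ - x₁) * (x₄ - x₁) * (x₄ - x₃)) ^ 2
      + w₁ * w₃ * w₅ * ((x₃ - x₁) * (x₅ - x₁) * (x₅ - x₃)) ^ 2
      + w₁ * w₄ * w₅ * ((x₄ - x₁) * (x₅ - x₁) * (x₅ - x₄)) ^ 2
      + w₂ * w₃ * w₄ * ((x₃ - x₂) * (x₄ - x₂) * (x₄ - x₃)) ^ 2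
      + w₂ * w₃ * w₅ * ((x₃ - x₂) * (x₅ - x₂) * (x₅ - x₃)) ^ 2
      + w₂ * w₄ * w₅ * ((x₄ - x₂) * (x₅ - x₂) * (x₅ - x₄)) ^ 2
      + w₃ * w₄ * w₅ * ((x₄ - x₃) * (x₅ - x₃) * (x₅ - x₄)) ^ 2)
        = (w₁ * w₂ * w₃ * ((x₂ - x₁) * (x₃ - x₁) * (x₃ - x₂)) ^ 2
      + w₁ * w₂ * w₄ * ((x₂ - x₁) * (x₄ - x₁) * (x₄ - x₂)) ^ 2
      + w₁ * w₂ * w₅ * ((x₂ - x₁) * (x₅ - x₁) * (x₅ - x₂)) ^ 2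
      + w₁ * w₃ * w₄ * ((x₃ - x₁) * (x₄ - x₁) * (x₄ - x₃)) ^ 2
      + w₁ * w₃ * w₅ * ((x₃ - x₁) * (x₅ - x₁) * (x₅ - x₃)) ^ 2
      + w₁ * w₄ * w₅ * ((x₄ - x₁) * (x₅ - x₁) * (x₅ - x₄)) ^ 2)
          + (w₂ * w₃ * w₄ * ((x₃ - x₂) * (x₄ - x₂) * (x₄ - x₃)) ^ 2
      + w₂ * w₃ * w₅ * ((x₃ - x₂) * (x₅ - x₂) * (x₅ - x₃)) ^ 2
      + w₂ * w₄ * w₅ * ((x₄ - x₂) * (x₅ - x₂) * (x₅ - x₄)) ^ 2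
      + w₃ * w₄ * w₅ * ((x₄ - x₃) * (x₅ - x₃) * (x₅ - x₄)) ^ 2) := by ring
    have i3 : (w₁ * w₂ * w₃ * ((x₂ - x₁) * (x₃ - x₁) * (x₃ - x₂)) ^ 2
      + w₁ * w₂ * w₄ * ((x₂ - x₁) * (x₄ - x₁) * (x₄ - x₂)) ^ 2
      + w₁ * w₂ * w₅ * ((x₂ - x₁) * (x₅ - x₁) * (x₅ - x₂)) ^ 2
      + w₁ * w₃ * w₄ * ((x₃ - x₁) * (x₄ - x₁) * (x₄ - x₃)) ^ 2
      + w₁ * w₃ * w₅ * ((x₃ - x₁) * (x₅ - x₁) * (x₅ - x₃)) ^ 2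
      + w₁ * w₄ * w₅ * ((x₄ - x₁) * (x₅ - x₁) * (x₅ - x₄)) ^ 2)
        = (w₁ * w₂ * w₃ * ((x₂ - x₁) * (x₃ - x₁) * (x₃ - x₂)) ^ 2
      + w₁ * w₂ * w₄ * ((x₂ - x₁) * (x₄ - x₁) * (x₄ - x₂)) ^ 2
      + w₁ * w₂ * w₅ * ((x₂ - x₁) * (x₅ - x₁) * (x₅ - x₂)) ^ 2
      + w₁ * w₃ * w₄ * ((x₃ - x₁) * (x₄ - x₁) * (x₄ - x₃)) ^ 2
      + w₁ * w₃ * w₅ * ((x₃ - x₁) * (x₅ - x₁) * (x₅ - x₃)) ^ 2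
      + w₁ * w₄ * w₅ * ((x₄ - x₁) * (x₅ - x₁) * (x₅ - x₄)) ^ 2) := by ring
    have o4 : (w₂ * w₃ * w₄ * w₅ * ((x₃ - x₂) * (x₄ - x₂) * (x₅ - x₂) * (x₄ - x₃) * (x₅ - x₃) * (x₅ - x₄)) ^ 2)
        = (w₂ * w₃ * w₄ * w₅ * ((x₃ - x₂) * (x₄ - x₂) * (x₅ - x₂) * (x₄ - x₃) * (x₅ - x₃) * (x₅ - x₄)) ^ 2) := by ring
    have i4 : (w₁ * w₂ * w₃ * w₄ * ((x₂ - x₁) * (x₃ - x₁) * (x₄ - x₁) * (x₃ - x₂) * (x₄ - x₂) * (x₄ - x₃)) ^ 2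
      + w₁ * w₂ * w₃ * w₅ * ((x₂ - x₁) * (x₃ - x₁) * (x₅ - x₁) * (x₃ - x₂) * (x₅ - x₂) * (x₅ - x₃)) ^ 2
      + w₁ * w₂ * w₄ * w₅ * ((x₂ - x₁) * (x₄ - x₁) * (x₅ - x₁) * (x₄ - x₂) * (x₅ - x₂) * (x₅ - x₄)) ^ 2
      + w₁ * w₃ * w₄ * w₅ * ((x₃ - x₁) * (x₄ - x₁) * (x₅ - x₁) * (x₄ - x₃) * (x₅ - x₃) * (x₅ - x₄)) ^ 2)
        = (w₁ * w₂ * w₃ * w₄ * ((x₂ - x₁) * (x₃ - x₁) * (x₄ - x₁) * (x₃ - x₂) * (x₄ - x₂) * (x₄ - x₃)) ^ 2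
      + w₁ * w₂ * w₃ * w₅ * ((x₂ - x₁) * (x₃ - x₁) * (x₅ - x₁) * (x₃ - x₂) * (x₅ - x₂) * (x₅ - x₃)) ^ 2
      + w₁ * w₂ * w₄ * w₅ * ((x₂ - x₁) * (x₄ - x₁) * (x₅ - x₁) * (x₄ - x₂) * (x₅ - x₂) * (x₅ - x₄)) ^ 2
      + w₁ * w₃ * w₄ * w₅ * ((x₃ - x₁) * (x₄ - x₁) * (x₅ - x₁) * (x₄ - x₃) * (x₅ - x₃) * (x₅ - x₄)) ^ 2) := by ring
    rw [c2, i2] at L1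
    rw [c3, i3] at L2
    rw [o4, i4, hO] at L3
    exact Or.inl ⟨hm, cover_case _ _ _ _ _ _ _ hw₁ hm (by positivity) (by positivity)
      (by positivity) L1 L2 L3⟩
  · -- level 2
    have hS : (w₂ + w₁ + w₃ + w₄ + w₅) = 1 := by linarith only [hs]
    have hO : w₁ + w₃ + w₄ + w₅ = 1 - w₂ := by linarith only [hs]
    have L := letters₅ x₂ x₁ x₃ x₄ x₅ w₂ w₁ w₃ w₄ w₅ hw₂ hw₁ hw₃ hw₄ hw₅
      (ne_of_gt h12)
    obtain ⟨L1, L2, L3⟩ := L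
    rw [hS] at L1 L2
    have c2 : (w₂ * w₁ * ((x₁ - x₂)) ^ 2 + w₂ * w₃ * ((x₃ - x₂)) ^ 2 + w₂ * w₄ * ((x₄ - x₂)) ^ 2
      + w₂ * w₅ * ((x₅ - x₂)) ^ 2 + w₁ * w₃ * ((x₃ - x₁)) ^ 2 + w₁ * w₄ * ((x₄ - x₁)) ^ 2
      + w₁ * w₅ * ((x₅ - x₁)) ^ 2 + w₃ * w₄ * ((x₄ - x₃)) ^ 2 + w₃ * w₅ * ((x₅ - x₃)) ^ 2
      + w₄ * w₅ * ((x₅ - x₄)) ^ 2)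
        = (w₁ * w₂ * ((x₂ - x₁)) ^ 2 + w₂ * w₃ * ((x₃ - x₂)) ^ 2 + w₂ * w₄ * ((x₄ - x₂)) ^ 2
      + w₂ * w₅ * ((x₅ - x₂)) ^ 2)
          + (w₁ * w₃ * ((x₃ - x₁)) ^ 2 + w₁ * w₄ * ((x₄ - x₁)) ^ 2 + w₁ * w₅ * ((x₅ - x₁)) ^ 2
      + w₃ * w₄ * ((x₄ - x₃)) ^ 2 + w₃ * w₅ * ((x₅ - x₃)) ^ 2 + w₄ * w₅ * ((x₅ - x₄)) ^ 2) := by ring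
    have i2 : (w₂ * w₁ * ((x₁ - x₂)) ^ 2 + w₂ * w₃ * ((x₃ - x₂)) ^ 2 + w₂ * w₄ * ((x₄ - x₂)) ^ 2
      + w₂ * w₅ * ((x₅ - x₂)) ^ 2)
        = (w₁ * w₂ * ((x₂ - x₁)) ^ 2 + w₂ * w₃ * ((x₃ - x₂)) ^ 2 + w₂ * w₄ * ((x₄ - x₂)) ^ 2
      + w₂ * w₅ * ((x₅ - x₂)) ^ 2) := by ring
    have c3 : (w₂ * w₁ * w₃ * ((x₁ - x₂) * (x₃ - x₂) * (x₃ - x₁)) ^ 2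
      + w₂ * w₁ * w₄ * ((x₁ - x₂) * (x₄ - x₂) * (x₄ - x₁)) ^ 2
      + w₂ * w₁ * w₅ * ((x₁ - x₂) * (x₅ - x₂) * (x₅ - x₁)) ^ 2
      + w₂ * w₃ * w₄ * ((x₃ - x₂) * (x₄ - x₂) * (x₄ - x₃)) ^ 2
      + w₂ * w₃ * w₅ * ((x₃ - x₂) * (x₅ - x₂) * (x₅ - x₃)) ^ 2
      + w₂ * w₄ * w₅ * ((x₄ - x₂) * (x₅ - x₂) * (x₅ - x₄)) ^ 2
      + w₁ * w₃ * w₄ * ((x₃ - x₁) * (x₄ - x₁) * (x₄ - x₃)) ^ 2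
      + w₁ * w₃ * w₅ * ((x₃ - x₁) * (x₅ - x₁) * (x₅ - x₃)) ^ 2
      + w₁ * w₄ * w₅ * ((x₄ - x₁) * (x₅ - x₁) * (x₅ - x₄)) ^ 2
      + w₃ * w₄ * w₅ * ((x₄ - x₃) * (x₅ - x₃) * (x₅ - x₄)) ^ 2)
        = (w₁ * w₂ * w₃ * ((x₂ - x₁) * (x₃ - x₁) * (x₃ - x₂)) ^ 2
      + w₁ * w₂ * w₄ * ((x₂ - x₁) * (x₄ - x₁) * (x₄ - x₂)) ^ 2
      + w₁ * w₂ * w₅ * ((x₂ - x₁) * (x₅ - x₁) * (x₅ - x₂)) ^ 2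
      + w₂ * w₃ * w₄ * ((x₃ - x₂) * (x₄ - x₂) * (x₄ - x₃)) ^ 2
      + w₂ * w₃ * w₅ * ((x₃ - x₂) * (x₅ - x₂) * (x₅ - x₃)) ^ 2
      + w₂ * w₄ * w₅ * ((x₄ - x₂) * (x₅ - x₂) * (x₅ - x₄)) ^ 2)
          + (w₁ * w₃ * w₄ * ((x₃ - x₁) * (x₄ - x₁) * (x₄ - x₃)) ^ 2
      + w₁ * w₃ * w₅ * ((x₃ - x₁) * (x₅ - x₁) * (x₅ - x₃)) ^ 2
      + w₁ * w₄ * w₅ * ((x₄ - x₁) * (x₅ - x₁) * (x₅ - x₄)) ^ 2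
      + w₃ * w₄ * w₅ * ((x₄ - x₃) * (x₅ - x₃) * (x₅ - x₄)) ^ 2) := by ring
    have i3 : (w₂ * w₁ * w₃ * ((x₁ - x₂) * (x₃ - x₂) * (x₃ - x₁)) ^ 2
      + w₂ * w₁ * w₄ * ((x₁ - x₂) * (x₄ - x₂) * (x₄ - x₁)) ^ 2
      + w₂ * w₁ * w₅ * ((x₁ - x₂) * (x₅ - x₂) * (x₅ - x₁)) ^ 2
      + w₂ * w₃ * w₄ * ((x₃ - x₂) * (x₄ - x₂) * (x₄ - x₃)) ^ 2
      + w₂ * w₃ * w₅ * ((x₃ - x₂) * (x₅ - x₂) * (x₅ - x₃)) ^ 2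
      + w₂ * w₄ * w₅ * ((x₄ - x₂) * (x₅ - x₂) * (x₅ - x₄)) ^ 2)
        = (w₁ * w₂ * w₃ * ((x₂ - x₁) * (x₃ - x₁) * (x₃ - x₂)) ^ 2
      + w₁ * w₂ * w₄ * ((x₂ - x₁) * (x₄ - x₁) * (x₄ - x₂)) ^ 2
      + w₁ * w₂ * w₅ * ((x₂ - x₁) * (x₅ - x₁) * (x₅ - x₂)) ^ 2
      + w₂ * w₃ * w₄ * ((x₃ - x₂) * (x₄ - x₂) * (x₄ - x₃)) ^ 2
      + w₂ * w₃ * w₅ * ((x₃ - x₂) * (x₅ - x₂) * (x₅ - x₃)) ^ 2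
      + w₂ * w₄ * w₅ * ((x₄ - x₂) * (x₅ - x₂) * (x₅ - x₄)) ^ 2) := by ring
    have o4 : (w₁ * w₃ * w₄ * w₅ * ((x₃ - x₁) * (x₄ - x₁) * (x₅ - x₁) * (x₄ - x₃) * (x₅ - x₃) * (x₅ - x₄)) ^ 2)
        = (w₁ * w₃ * w₄ * w₅ * ((x₃ - x₁) * (x₄ - x₁) * (x₅ - x₁) * (x₄ - x₃) * (x₅ - x₃) * (x₅ - x₄)) ^ 2) := by ring
    have i4 : (w₂ * w₁ * w₃ * w₄ * ((x₁ - x₂) * (x₃ - x₂) * (x₄ - x₂) * (x₃ - x₁) * (x₄ - x₁) * (x₄ - x₃)) ^ 2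
      + w₂ * w₁ * w₃ * w₅ * ((x₁ - x₂) * (x₃ - x₂) * (x₅ - x₂) * (x₃ - x₁) * (x₅ - x₁) * (x₅ - x₃)) ^ 2
      + w₂ * w₁ * w₄ * w₅ * ((x₁ - x₂) * (x₄ - x₂) * (x₅ - x₂) * (x₄ - x₁) * (x₅ - x₁) * (x₅ - x₄)) ^ 2
      + w₂ * w₃ * w₄ * w₅ * ((x₃ - x₂) * (x₄ - x₂) * (x₅ - x₂) * (x₄ - x₃) * (x₅ - x₃) * (x₅ - x₄)) ^ 2)
        = (w₁ * w₂ * w₃ * w₄ * ((x₂ - x₁) * (x₃ - x₁) * (x₄ - x₁) * (x₃ - x₂) * (x₄ - x₂) * (x₄ - x₃)) ^ 2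
      + w₁ * w₂ * w₃ * w₅ * ((x₂ - x₁) * (x₃ - x₁) * (x₅ - x₁) * (x₃ - x₂) * (x₅ - x₂) * (x₅ - x₃)) ^ 2
      + w₁ * w₂ * w₄ * w₅ * ((x₂ - x₁) * (x₄ - x₁) * (x₅ - x₁) * (x₄ - x₂) * (x₅ - x₂) * (x₅ - x₄)) ^ 2
      + w₂ * w₃ * w₄ * w₅ * ((x₃ - x₂) * (x₄ - x₂) * (x₅ - x₂) * (x₄ - x₃) * (x₅ - x₃) * (x₅ - x₄)) ^ 2) := by ring
    rw [c2, i2] at L1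
    rw [c3, i3] at L2
    rw [o4, i4, hO] at L3
    exact Or.inr <| Or.inl ⟨hm, cover_case _ _ _ _ _ _ _ hw₂ hm (by positivity) (by positivity)
      (by positivity) L1 L2 L3⟩
  · -- level 3
    have hS : (w₃ + w₁ + w₂ + w₄ + w₅) = 1 := by linarith only [hs]
    have hO : w₁ + w₂ + w₄ + w₅ = 1 - w₃ := by linarith only [hs]
    have L := letters₅ x₃ x₁ x₂ x₄ x₅ w₃ w₁ w₂ w₄ w₅ hw₃ hw₁ hw₂ hw₄ hw₅
      (ne_of_gt (lt_trans h12 h23))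
    obtain ⟨L1, L2, L3⟩ := L
    rw [hS] at L1 L2
    have c2 : (w₃ * w₁ * ((x₁ - x₃)) ^ 2 + w₃ * w₂ * ((x₂ - x₃)) ^ 2 + w₃ * w₄ * ((x₄ - x₃)) ^ 2
      + w₃ * w₅ * ((x₅ - x₃)) ^ 2 + w₁ * w₂ * ((x₂ - x₁)) ^ 2 + w₁ * w₄ * ((x₄ - x₁)) ^ 2
      + w₁ * w₅ * ((x₅ - x₁)) ^ 2 + w₂ * w₄ * ((x₄ - x₂)) ^ 2 + w₂ * w₅ * ((x₅ - x₂)) ^ 2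
      + w₄ * w₅ * ((x₅ - x₄)) ^ 2)
        = (w₁ * w₃ * ((x₃ - x₁)) ^ 2 + w₂ * w₃ * ((x₃ - x₂)) ^ 2 + w₃ * w₄ * ((x₄ - x₃)) ^ 2
      + w₃ * w₅ * ((x₅ - x₃)) ^ 2)
          + (w₁ * w₂ * ((x₂ - x₁)) ^ 2 + w₁ * w₄ * ((x₄ - x₁)) ^ 2 + w₁ * w₅ * ((x₅ - x₁)) ^ 2
      + w₂ * w₄ * ((x₄ - x₂)) ^ 2 + w₂ * w₅ * ((x₅ - x₂)) ^ 2 + w₄ * w₅ * ((x₅ - x₄)) ^ 2) := by ring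
    have i2 : (w₃ * w₁ * ((x₁ - x₃)) ^ 2 + w₃ * w₂ * ((x₂ - x₃)) ^ 2 + w₃ * w₄ * ((x₄ - x₃)) ^ 2
      + w₃ * w₅ * ((x₅ - x₃)) ^ 2)
        = (w₁ * w₃ * ((x₃ - x₁)) ^ 2 + w₂ * w₃ * ((x₃ - x₂)) ^ 2 + w₃ * w₄ * ((x₄ - x₃)) ^ 2
      + w₃ * w₅ * ((x₅ - x₃)) ^ 2) := by ring
    have c3 : (w₃ * w₁ * w₂ * ((x₁ - x₃) * (x₂ - x₃) * (x₂ - x₁)) ^ 2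
      + w₃ * w₁ * w₄ * ((x₁ - x₃) * (x₄ - x₃) * (x₄ - x₁)) ^ 2
      + w₃ * w₁ * w₅ * ((x₁ - x₃) * (x₅ - x₃) * (x₅ - x₁)) ^ 2
      + w₃ * w₂ * w₄ * ((x₂ - x₃) * (x₄ - x₃) * (x₄ - x₂)) ^ 2
      + w₃ * w₂ * w₅ * ((x₂ - x₃) * (x₅ - x₃) * (x₅ - x₂)) ^ 2
      + w₃ * w₄ * w₅ * ((x₄ - x₃) * (x₅ - x₃) * (x₅ - x₄)) ^ 2
      + w₁ * w₂ * w₄ * ((x₂ - x₁) * (x₄ - x₁) * (x₄ - x₂)) ^ 2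
      + w₁ * w₂ * w₅ * ((x₂ - x₁) * (x₅ - x₁) * (x₅ - x₂)) ^ 2
      + w₁ * w₄ * w₅ * ((x₄ - x₁) * (x₅ - x₁) * (x₅ - x₄)) ^ 2
      + w₂ * w₄ * w₅ * ((x₄ - x₂) * (x₅ - x₂) * (x₅ - x₄)) ^ 2)
        = (w₁ * w₂ * w₃ * ((x₂ - x₁) * (x₃ - x₁) * (x₃ - x₂)) ^ 2
      + w₁ * w₃ * w₄ * ((x₃ - x₁) * (x₄ - x₁) * (x₄ - x₃)) ^ 2
      + w₁ * w₃ * w₅ * ((x₃ - x₁) * (x₅ - x₁) * (x₅ - x₃)) ^ 2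
      + w₂ * w₃ * w₄ * ((x₃ - x₂) * (x₄ - x₂) * (x₄ - x₃)) ^ 2
      + w₂ * w₃ * w₅ * ((x₃ - x₂) * (x₅ - x₂) * (x₅ - x₃)) ^ 2
      + w₃ * w₄ * w₅ * ((x₄ - x₃) * (x₅ - x₃) * (x₅ - x₄)) ^ 2)
          + (w₁ * w₂ * w₄ * ((x₂ - x₁) * (x₄ - x₁) * (x₄ - x₂)) ^ 2
      + w₁ * w₂ * w₅ * ((x₂ - x₁) * (x₅ - x₁) * (x₅ - x₂)) ^ 2
      + w₁ * w₄ * w₅ * ((x₄ - x₁) * (x₅ - x₁) * (x₅ - x₄)) ^ 2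
      + w₂ * w₄ * w₅ * ((x₄ - x₂) * (x₅ - x₂) * (x₅ - x₄)) ^ 2) := by ring
    have i3 : (w₃ * w₁ * w₂ * ((x₁ - x₃) * (x₂ - x₃) * (x₂ - x₁)) ^ 2
      + w₃ * w₁ * w₄ * ((x₁ - x₃) * (x₄ - x₃) * (x₄ - x₁)) ^ 2
      + w₃ * w₁ * w₅ * ((x₁ - x₃) * (x₅ - x₃) * (x₅ - x₁)) ^ 2
      + w₃ * w₂ * w₄ * ((x₂ - x₃) * (x₄ - x₃) * (x₄ - x₂)) ^ 2
      + w₃ * w₂ * w₅ * ((x₂ - x₃) * (x₅ - x₃) * (x₅ - x₂)) ^ 2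
      + w₃ * w₄ * w₅ * ((x₄ - x₃) * (x₅ - x₃) * (x₅ - x₄)) ^ 2)
        = (w₁ * w₂ * w₃ * ((x₂ - x₁) * (x₃ - x₁) * (x₃ - x₂)) ^ 2
      + w₁ * w₃ * w₄ * ((x₃ - x₁) * (x₄ - x₁) * (x₄ - x₃)) ^ 2
      + w₁ * w₃ * w₅ * ((x₃ - x₁) * (x₅ - x₁) * (x₅ - x₃)) ^ 2
      + w₂ * w₃ * w₄ * ((x₃ - x₂) * (x₄ - x₂) * (x₄ - x₃)) ^ 2
      + w₂ * w₃ * w₅ * ((x₃ - x₂) * (x₅ - x₂) * (x₅ - x₃)) ^ 2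
      + w₃ * w₄ * w₅ * ((x₄ - x₃) * (x₅ - x₃) * (x₅ - x₄)) ^ 2) := by ring
    have o4 : (w₁ * w₂ * w₄ * w₅ * ((x₂ - x₁) * (x₄ - x₁) * (x₅ - x₁) * (x₄ - x₂) * (x₅ - x₂) * (x₅ - x₄)) ^ 2)
        = (w₁ * w₂ * w₄ * w₅ * ((x₂ - x₁) * (x₄ - x₁) * (x₅ - x₁) * (x₄ - x₂) * (x₅ - x₂) * (x₅ - x₄)) ^ 2) := by ring
    have i4 : (w₃ * w₁ * w₂ * w₄ * ((x₁ - x₃) * (x₂ - x₃) * (x₄ - x₃) * (x₂ - x₁) * (x₄ - x₁) * (x₄ - x₂)) ^ 2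
      + w₃ * w₁ * w₂ * w₅ * ((x₁ - x₃) * (x₂ - x₃) * (x₅ - x₃) * (x₂ - x₁) * (x₅ - x₁) * (x₅ - x₂)) ^ 2
      + w₃ * w₁ * w₄ * w₅ * ((x₁ - x₃) * (x₄ - x₃) * (x₅ - x₃) * (x₄ - x₁) * (x₅ - x₁) * (x₅ - x₄)) ^ 2
      + w₃ * w₂ * w₄ * w₅ * ((x₂ - x₃) * (x₄ - x₃) * (x₅ - x₃) * (x₄ - x₂) * (x₅ - x₂) * (x₅ - x₄)) ^ 2)
        = (w₁ * w₂ * w₃ * w₄ * ((x₂ - x₁) * (x₃ - x₁) * (x₄ - x₁) * (x₃ - x₂) * (x₄ - x₂) * (x₄ - x₃)) ^ 2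
      + w₁ * w₂ * w₃ * w₅ * ((x₂ - x₁) * (x₃ - x₁) * (x₅ - x₁) * (x₃ - x₂) * (x₅ - x₂) * (x₅ - x₃)) ^ 2
      + w₁ * w₃ * w₄ * w₅ * ((x₃ - x₁) * (x₄ - x₁) * (x₅ - x₁) * (x₄ - x₃) * (x₅ - x₃) * (x₅ - x₄)) ^ 2
      + w₂ * w₃ * w₄ * w₅ * ((x₃ - x₂) * (x₄ - x₂) * (x₅ - x₂) * (x₄ - x₃) * (x₅ - x₃) * (x₅ - x₄)) ^ 2) := by ring
    rw [c2, i2] at L1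
    rw [c3, i3] at L2
    rw [o4, i4, hO] at L3
    exact Or.inr <| Or.inr <| Or.inl ⟨hm, cover_case _ _ _ _ _ _ _ hw₃ hm (by positivity) (by positivity)
      (by positivity) L1 L2 L3⟩
  · -- level 4
    have hS : (w₄ + w₁ + w₂ + w₃ + w₅) = 1 := by linarith only [hs]
    have hO : w₁ + w₂ + w₃ + w₅ = 1 - w₄ := by linarith only [hs]
    have L := letters₅ x₄ x₁ x₂ x₃ x₅ w₄ w₁ w₂ w₃ w₅ hw₄ hw₁ hw₂ hw₃ hw₅
      (ne_of_gt (lt_trans (lt_trans h12 h23) h34))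
    obtain ⟨L1, L2, L3⟩ := L
    rw [hS] at L1 L2
    have c2 : (w₄ * w₁ * ((x₁ - x₄)) ^ 2 + w₄ * w₂ * ((x₂ - x₄)) ^ 2 + w₄ * w₃ * ((x₃ - x₄)) ^ 2
      + w₄ * w₅ * ((x₅ - x₄)) ^ 2 + w₁ * w₂ * ((x₂ - x₁)) ^ 2 + w₁ * w₃ * ((x₃ - x₁)) ^ 2
      + w₁ * w₅ * ((x₅ - x₁)) ^ 2 + w₂ * w₃ * ((x₃ - x₂)) ^ 2 + w₂ * w₅ * ((x₅ - x₂)) ^ 2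
      + w₃ * w₅ * ((x₅ - x₃)) ^ 2)
        = (w₁ * w₄ * ((x₄ - x₁)) ^ 2 + w₂ * w₄ * ((x₄ - x₂)) ^ 2 + w₃ * w₄ * ((x₄ - x₃)) ^ 2
      + w₄ * w₅ * ((x₅ - x₄)) ^ 2)
          + (w₁ * w₂ * ((x₂ - x₁)) ^ 2 + w₁ * w₃ * ((x₃ - x₁)) ^ 2 + w₁ * w₅ * ((x₅ - x₁)) ^ 2
      + w₂ * w₃ * ((x₃ - x₂)) ^ 2 + w₂ * w₅ * ((x₅ - x₂)) ^ 2 + w₃ * w₅ * ((x₅ - x₃)) ^ 2) := by ring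
    have i2 : (w₄ * w₁ * ((x₁ - x₄)) ^ 2 + w₄ * w₂ * ((x₂ - x₄)) ^ 2 + w₄ * w₃ * ((x₃ - x₄)) ^ 2
      + w₄ * w₅ * ((x₅ - x₄)) ^ 2)
        = (w₁ * w₄ * ((x₄ - x₁)) ^ 2 + w₂ * w₄ * ((x₄ - x₂)) ^ 2 + w₃ * w₄ * ((x₄ - x₃)) ^ 2
      + w₄ * w₅ * ((x₅ - x₄)) ^ 2) := by ring
    have c3 : (w₄ * w₁ * w₂ * ((x₁ - x₄) * (x₂ - x₄) * (x₂ - x₁)) ^ 2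
      + w₄ * w₁ * w₃ * ((x₁ - x₄) * (x₃ - x₄) * (x₃ - x₁)) ^ 2
      + w₄ * w₁ * w₅ * ((x₁ - x₄) * (x₅ - x₄) * (x₅ - x₁)) ^ 2
      + w₄ * w₂ * w₃ * ((x₂ - x₄) * (x₃ - x₄) * (x₃ - x₂)) ^ 2
      + w₄ * w₂ * w₅ * ((x₂ - x₄) * (x₅ - x₄) * (x₅ - x₂)) ^ 2
      + w₄ * w₃ * w₅ * ((x₃ - x₄) * (x₅ - x₄) * (x₅ - x₃)) ^ 2
      + w₁ * w₂ * w₃ * ((x₂ - x₁) * (x₃ - x₁) * (x₃ - x₂)) ^ 2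
      + w₁ * w₂ * w₅ * ((x₂ - x₁) * (x₅ - x₁) * (x₅ - x₂)) ^ 2
      + w₁ * w₃ * w₅ * ((x₃ - x₁) * (x₅ - x₁) * (x₅ - x₃)) ^ 2
      + w₂ * w₃ * w₅ * ((x₃ - x₂) * (x₅ - x₂) * (x₅ - x₃)) ^ 2)
        = (w₁ * w₂ * w₄ * ((x₂ - x₁) * (x₄ - x₁) * (x₄ - x₂)) ^ 2
      + w₁ * w₃ * w₄ * ((x₃ - x₁) * (x₄ - x₁) * (x₄ - x₃)) ^ 2
      + w₁ * w₄ * w₅ * ((x₄ - x₁) * (x₅ - x₁) * (x₅ - x₄)) ^ 2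
      + w₂ * w₃ * w₄ * ((x₃ - x₂) * (x₄ - x₂) * (x₄ - x₃)) ^ 2
      + w₂ * w₄ * w₅ * ((x₄ - x₂) * (x₅ - x₂) * (x₅ - x₄)) ^ 2
      + w₃ * w₄ * w₅ * ((x₄ - x₃) * (x₅ - x₃) * (x₅ - x₄)) ^ 2)
          + (w₁ * w₂ * w₃ * ((x₂ - x₁) * (x₃ - x₁) * (x₃ - x₂)) ^ 2
      + w₁ * w₂ * w₅ * ((x₂ - x₁) * (x₅ - x₁) * (x₅ - x₂)) ^ 2
      + w₁ * w₃ * w₅ * ((x₃ - x₁) * (x₅ - x₁) * (x₅ - x₃)) ^ 2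
      + w₂ * w₃ * w₅ * ((x₃ - x₂) * (x₅ - x₂) * (x₅ - x₃)) ^ 2) := by ring
    have i3 : (w₄ * w₁ * w₂ * ((x₁ - x₄) * (x₂ - x₄) * (x₂ - x₁)) ^ 2
      + w₄ * w₁ * w₃ * ((x₁ - x₄) * (x₃ - x₄) * (x₃ - x₁)) ^ 2
      + w₄ * w₁ * w₅ * ((x₁ - x₄) * (x₅ - x₄) * (x₅ - x₁)) ^ 2
      + w₄ * w₂ * w₃ * ((x₂ - x₄) * (x₃ - x₄) * (x₃ - x₂)) ^ 2
      + w₄ * w₂ * w₅ * ((x₂ - x₄) * (x₅ - x₄) * (x₅ - x₂)) ^ 2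
      + w₄ * w₃ * w₅ * ((x₃ - x₄) * (x₅ - x₄) * (x₅ - x₃)) ^ 2)
        = (w₁ * w₂ * w₄ * ((x₂ - x₁) * (x₄ - x₁) * (x₄ - x₂)) ^ 2
      + w₁ * w₃ * w₄ * ((x₃ - x₁) * (x₄ - x₁) * (x₄ - x₃)) ^ 2
      + w₁ * w₄ * w₅ * ((x₄ - x₁) * (x₅ - x₁) * (x₅ - x₄)) ^ 2
      + w₂ * w₃ * w₄ * ((x₃ - x₂) * (x₄ - x₂) * (x₄ - x₃)) ^ 2
      + w₂ * w₄ * w₅ * ((x₄ - x₂) * (x₅ - x₂) * (x₅ - x₄)) ^ 2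
      + w₃ * w₄ * w₅ * ((x₄ - x₃) * (x₅ - x₃) * (x₅ - x₄)) ^ 2) := by ring
    have o4 : (w₁ * w₂ * w₃ * w₅ * ((x₂ - x₁) * (x₃ - x₁) * (x₅ - x₁) * (x₃ - x₂) * (x₅ - x₂) * (x₅ - x₃)) ^ 2)
        = (w₁ * w₂ * w₃ * w₅ * ((x₂ - x₁) * (x₃ - x₁) * (x₅ - x₁) * (x₃ - x₂) * (x₅ - x₂) * (x₅ - x₃)) ^ 2) := by ring
    have i4 : (w₄ * w₁ * w₂ * w₃ * ((x₁ - x₄) * (x₂ - x₄) * (x₃ - x₄) * (x₂ - x₁) * (x₃ - x₁) * (x₃ - x₂)) ^ 2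
      + w₄ * w₁ * w₂ * w₅ * ((x₁ - x₄) * (x₂ - x₄) * (x₅ - x₄) * (x₂ - x₁) * (x₅ - x₁) * (x₅ - x₂)) ^ 2
      + w₄ * w₁ * w₃ * w₅ * ((x₁ - x₄) * (x₃ - x₄) * (x₅ - x₄) * (x₃ - x₁) * (x₅ - x₁) * (x₅ - x₃)) ^ 2
      + w₄ * w₂ * w₃ * w₅ * ((x₂ - x₄) * (x₃ - x₄) * (x₅ - x₄) * (x₃ - x₂) * (x₅ - x₂) * (x₅ - x₃)) ^ 2)
        = (w₁ * w₂ * w₃ * w₄ * ((x₂ - x₁) * (x₃ - x₁) * (x₄ - x₁) * (x₃ - x₂) * (x₄ - x₂) * (x₄ - x₃)) ^ 2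
      + w₁ * w₂ * w₄ * w₅ * ((x₂ - x₁) * (x₄ - x₁) * (x₅ - x₁) * (x₄ - x₂) * (x₅ - x₂) * (x₅ - x₄)) ^ 2
      + w₁ * w₃ * w₄ * w₅ * ((x₃ - x₁) * (x₄ - x₁) * (x₅ - x₁) * (x₄ - x₃) * (x₅ - x₃) * (x₅ - x₄)) ^ 2
      + w₂ * w₃ * w₄ * w₅ * ((x₃ - x₂) * (x₄ - x₂) * (x₅ - x₂) * (x₄ - x₃) * (x₅ - x₃) * (x₅ - x₄)) ^ 2) := by ring
    rw [c2, i2] at L1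
    rw [c3, i3] at L2
    rw [o4, i4, hO] at L3
    exact Or.inr <| Or.inr <| Or.inr <| Or.inl ⟨hm, cover_case _ _ _ _ _ _ _ hw₄ hm (by positivity) (by positivity)
      (by positivity) L1 L2 L3⟩
  · -- level 5
    have hS : (w₅ + w₁ + w₂ + w₃ + w₄) = 1 := by linarith only [hs]
    have hO : w₁ + w₂ + w₃ + w₄ = 1 - w₅ := by linarith only [hs]
    have L := letters₅ x₅ x₁ x₂ x₃ x₄ w₅ w₁ w₂ w₃ w₄ hw₅ hw₁ hw₂ hw₃ hw₄
      (ne_of_gt (lt_trans (lt_trans (lt_trans h12 h23) h34) h45))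
    obtain ⟨L1, L2, L3⟩ := L
    rw [hS] at L1 L2
    have c2 : (w₅ * w₁ * ((x₁ - x₅)) ^ 2 + w₅ * w₂ * ((x₂ - x₅)) ^ 2 + w₅ * w₃ * ((x₃ - x₅)) ^ 2
      + w₅ * w₄ * ((x₄ - x₅)) ^ 2 + w₁ * w₂ * ((x₂ - x₁)) ^ 2 + w₁ * w₃ * ((x₃ - x₁)) ^ 2
      + w₁ * w₄ * ((x₄ - x₁)) ^ 2 + w₂ * w₃ * ((x₃ - x₂)) ^ 2 + w₂ * w₄ * ((x₄ - x₂)) ^ 2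
      + w₃ * w₄ * ((x₄ - x₃)) ^ 2)
        = (w₁ * w₅ * ((x₅ - x₁)) ^ 2 + w₂ * w₅ * ((x₅ - x₂)) ^ 2 + w₃ * w₅ * ((x₅ - x₃)) ^ 2
      + w₄ * w₅ * ((x₅ - x₄)) ^ 2)
          + (w₁ * w₂ * ((x₂ - x₁)) ^ 2 + w₁ * w₃ * ((x₃ - x₁)) ^ 2 + w₁ * w₄ * ((x₄ - x₁)) ^ 2
      + w₂ * w₃ * ((x₃ - x₂)) ^ 2 + w₂ * w₄ * ((x₄ - x₂)) ^ 2 + w₃ * w₄ * ((x₄ - x₃)) ^ 2) := by ring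
    have i2 : (w₅ * w₁ * ((x₁ - x₅)) ^ 2 + w₅ * w₂ * ((x₂ - x₅)) ^ 2 + w₅ * w₃ * ((x₃ - x₅)) ^ 2
      + w₅ * w₄ * ((x₄ - x₅)) ^ 2)
        = (w₁ * w₅ * ((x₅ - x₁)) ^ 2 + w₂ * w₅ * ((x₅ - x₂)) ^ 2 + w₃ * w₅ * ((x₅ - x₃)) ^ 2
      + w₄ * w₅ * ((x₅ - x₄)) ^ 2) := by ring
    have c3 : (w₅ * w₁ * w₂ * ((x₁ - x₅) * (x₂ - x₅) * (x₂ - x₁)) ^ 2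
      + w₅ * w₁ * w₃ * ((x₁ - x₅) * (x₃ - x₅) * (x₃ - x₁)) ^ 2
      + w₅ * w₁ * w₄ * ((x₁ - x₅) * (x₄ - x₅) * (x₄ - x₁)) ^ 2
      + w₅ * w₂ * w₃ * ((x₂ - x₅) * (x₃ - x₅) * (x₃ - x₂)) ^ 2
      + w₅ * w₂ * w₄ * ((x₂ - x₅) * (x₄ - x₅) * (x₄ - x₂)) ^ 2
      + w₅ * w₃ * w₄ * ((x₃ - x₅) * (x₄ - x₅) * (x₄ - x₃)) ^ 2
      + w₁ * w₂ * w₃ * ((x₂ - x₁) * (x₃ - x₁) * (x₃ - x₂)) ^ 2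
      + w₁ * w₂ * w₄ * ((x₂ - x₁) * (x₄ - x₁) * (x₄ - x₂)) ^ 2
      + w₁ * w₃ * w₄ * ((x₃ - x₁) * (x₄ - x₁) * (x₄ - x₃)) ^ 2
      + w₂ * w₃ * w₄ * ((x₃ - x₂) * (x₄ - x₂) * (x₄ - x₃)) ^ 2)
        = (w₁ * w₂ * w₅ * ((x₂ - x₁) * (x₅ - x₁) * (x₅ - x₂)) ^ 2
      + w₁ * w₃ * w₅ * ((x₃ - x₁) * (x₅ - x₁) * (x₅ - x₃)) ^ 2
      + w₁ * w₄ * w₅ * ((x₄ - x₁) * (x₅ - x₁) * (x₅ - x₄)) ^ 2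
      + w₂ * w₃ * w₅ * ((x₃ - x₂) * (x₅ - x₂) * (x₅ - x₃)) ^ 2
      + w₂ * w₄ * w₅ * ((x₄ - x₂) * (x₅ - x₂) * (x₅ - x₄)) ^ 2
      + w₃ * w₄ * w₅ * ((x₄ - x₃) * (x₅ - x₃) * (x₅ - x₄)) ^ 2)
          + (w₁ * w₂ * w₃ * ((x₂ - x₁) * (x₃ - x₁) * (x₃ - x₂)) ^ 2
      + w₁ * w₂ * w₄ * ((x₂ - x₁) * (x₄ - x₁) * (x₄ - x₂)) ^ 2
      + w₁ * w₃ * w₄ * ((x₃ - x₁) * (x₄ - x₁) * (x₄ - x₃)) ^ 2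
      + w₂ * w₃ * w₄ * ((x₃ - x₂) * (x₄ - x₂) * (x₄ - x₃)) ^ 2) := by ring
    have i3 : (w₅ * w₁ * w₂ * ((x₁ - x₅) * (x₂ - x₅) * (x₂ - x₁)) ^ 2
      + w₅ * w₁ * w₃ * ((x₁ - x₅) * (x₃ - x₅) * (x₃ - x₁)) ^ 2
      + w₅ * w₁ * w₄ * ((x₁ - x₅) * (x₄ - x₅) * (x₄ - x₁)) ^ 2
      + w₅ * w₂ * w₃ * ((x₂ - x₅) * (x₃ - x₅) * (x₃ - x₂)) ^ 2
      + w₅ * w₂ * w₄ * ((x₂ - x₅) * (x₄ - x₅) * (x₄ - x₂)) ^ 2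
      + w₅ * w₃ * w₄ * ((x₃ - x₅) * (x₄ - x₅) * (x₄ - x₃)) ^ 2)
        = (w₁ * w₂ * w₅ * ((x₂ - x₁) * (x₅ - x₁) * (x₅ - x₂)) ^ 2
      + w₁ * w₃ * w₅ * ((x₃ - x₁) * (x₅ - x₁) * (x₅ - x₃)) ^ 2
      + w₁ * w₄ * w₅ * ((x₄ - x₁) * (x₅ - x₁) * (x₅ - x₄)) ^ 2
      + w₂ * w₃ * w₅ * ((x₃ - x₂) * (x₅ - x₂) * (x₅ - x₃)) ^ 2
      + w₂ * w₄ * w₅ * ((x₄ - x₂) * (x₅ - x₂) * (x₅ - x₄)) ^ 2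
      + w₃ * w₄ * w₅ * ((x₄ - x₃) * (x₅ - x₃) * (x₅ - x₄)) ^ 2) := by ring
    have o4 : (w₁ * w₂ * w₃ * w₄ * ((x₂ - x₁) * (x₃ - x₁) * (x₄ - x₁) * (x₃ - x₂) * (x₄ - x₂) * (x₄ - x₃)) ^ 2)
        = (w₁ * w₂ * w₃ * w₄ * ((x₂ - x₁) * (x₃ - x₁) * (x₄ - x₁) * (x₃ - x₂) * (x₄ - x₂) * (x₄ - x₃)) ^ 2) := by ring
    have i4 : (w₅ * w₁ * w₂ * w₃ * ((x₁ - x₅) * (x₂ - x₅) * (x₃ - x₅) * (x₂ - x₁) * (x₃ - x₁) * (x₃ - x₂)) ^ 2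
      + w₅ * w₁ * w₂ * w₄ * ((x₁ - x₅) * (x₂ - x₅) * (x₄ - x₅) * (x₂ - x₁) * (x₄ - x₁) * (x₄ - x₂)) ^ 2
      + w₅ * w₁ * w₃ * w₄ * ((x₁ - x₅) * (x₃ - x₅) * (x₄ - x₅) * (x₃ - x₁) * (x₄ - x₁) * (x₄ - x₃)) ^ 2
      + w₅ * w₂ * w₃ * w₄ * ((x₂ - x₅) * (x₃ - x₅) * (x₄ - x₅) * (x₃ - x₂) * (x₄ - x₂) * (x₄ - x₃)) ^ 2)
        = (w₁ * w₂ * w₃ * w₅ * ((x₂ - x₁) * (x₃ - x₁) * (x₅ - x₁) * (x₃ - x₂) * (x₅ - x₂) * (x₅ - x₃)) ^ 2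
      + w₁ * w₂ * w₄ * w₅ * ((x₂ - x₁) * (x₄ - x₁) * (x₅ - x₁) * (x₄ - x₂) * (x₅ - x₂) * (x₅ - x₄)) ^ 2
      + w₁ * w₃ * w₄ * w₅ * ((x₃ - x₁) * (x₄ - x₁) * (x₅ - x₁) * (x₄ - x₃) * (x₅ - x₃) * (x₅ - x₄)) ^ 2
      + w₂ * w₃ * w₄ * w₅ * ((x₃ - x₂) * (x₄ - x₂) * (x₅ - x₂) * (x₄ - x₃) * (x₅ - x₃) * (x₅ - x₄)) ^ 2) := by ring
    rw [c2, i2] at L1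
    rw [c3, i3] at L2
    rw [o4, i4, hO] at L3
    exact Or.inr <| Or.inr <| Or.inr <| Or.inr ⟨hm, cover_case _ _ _ _ _ _ _ hw₅ hm (by positivity) (by positivity)
      (by positivity) L1 L2 L3⟩

end Literature.MathematicalPhysics.QuantumLattice.Imbrie2016
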